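import Literature.NumberTheory.Weil1964.AdelicMetaplecticTensorSchur
import Literature.NumberTheory.Weil1964.AdelicThetaTensorMajorants
import HarnessLib

/-!
# Theta majorants for the Weil representation along a continuous homomorphism

Topic `NumberTheory/Weil1964`; namespace `Literature.NumberTheory.Weil1964`. Origin: `pub-hodgecm`
MODEL-CONSTRUCTION sub-cell, vacancy (v19-b) = (W-1). REPRODUCTION of a published argument (Weil 1964, Chap. III
n° 41, Lemme 5 p. 192 and Théorème 6 (1) p. 193: on a compact set of the metaplectic group the functions `SΦ` are
dominated by one Schwartz–Bruhat function, whence the theta series converges locally uniformly). KERNEL MATHEMATICS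
ONLY: every declaration below is proved; no `def … : Prop` record, no cited hypothesis.

THE STATEMENT (`hasThetaMajorants_omega_comp`). Let `T ∈ GL_n(𝔸_F)`, let `H` be a topological group, let
`s : H →* Mp_ψ(W_𝔸)ᶜᵒⁿᵗ` (`adelicMpCont F (Fin n) T`) be a continuous homomorphism, and let `W∞ : H → (𝒮(F_∞ⁿ) →L 𝒮(F_∞ⁿ))`
be a family of non-zero continuous operators, pointwise continuous in `h` (`h ↦ W∞ h Φ` continuous into the Schwartz
space) and COVARIANT for the archimedean Heisenberg operators exactly as an archimedean factor of `ω(s h)` is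
(`arch_covariant_of_implements`: `W∞ h (archModTrans a w Φ) = weilPhase (π(s h)) (a,w) • archModTrans (a',w') (W∞ h Φ)`).
Then `h ↦ ω(s h)` has theta majorants (`HasThetaMajorants`): every term `h ↦ (ω(s h)Φ)(ξ)` is continuous and near every
`h₀` all the terms are dominated by one summable family on `Fⁿ` — so `h ↦ Θ(ω(s h)Φ)` is continuous
(`HasThetaMajorants.continuous_thetaDistLM`).

THE PROOF (all steps near `h = 1` first). (1) STRIPPING (§3–§4): for each `h`, `ω(s h) = A_h ⊗ M_h`
(`exists_finImplementer`, `exists_continuousLinearEquiv_of_mem_adelicMpCont`); `W∞ h` and `A_h` are projectively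
covariant with the same phase, so `A_h⁻¹ ∘ W∞ h` commutes with all archimedean Heisenberg operators and (Schur,
`eq_smul_of_commute_rhoSD`) `W∞ h = λ_h A_h`, `λ_h ≠ 0`: `ω(s h)(Ψ ⊗ φ) = (c_h W∞ h Ψ) ⊗ B_h φ` with `B_h` a finite
implementer of `π(s h)` (`exists_factors_of_archModTrans_covariant`). (2) LATTICE RIGIDITY (§1, §2, §5): for a compact
open subgroup `L` of `(𝔸_F^∞)ⁿ` the finite Heisenberg elements `π(s h⁻¹)·l̂` (`l ∈ L`) and `π(s h⁻¹)·ŷ` (`y ∈ L^♮`, the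
dual box — compact and open, `isCompact_dualBox`) still FIX `𝟙_L` for `h` near `1` (three open conditions, uniform on
the compact parameter sets by the tube lemma, `eventually_forall_finSchrodinger_act_indicatorSB`); so for such `h`
EVERY finite implementer `B` of `π(s h)` has `B 𝟙_L` fixed by the translations by `L` and the modulations by `L^♮`,
whence (`eq_smul_indicatorSB_of_fixed`) `B 𝟙_L = μ 𝟙_L` (`eventually_implementer_indicatorSB_eq_smul`). (3) ONE SCALAR
(§6): consequently, near `1`, `ω(s h)(Ψ ⊗ ρ_f(η)𝟙_L) = (κ_h W∞ h Ψ) ⊗ ρ_f(π(s h)η) 𝟙_L` for ALL `Ψ` and all finite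
`η` with one scalar `κ_h` (`eventually_exists_generator_factor`), and `|κ_h| ≤ K` near `1` by evaluating one matrix
coefficient (`exists_bound_generator_factor`; no continuity of `κ` is needed). The generators `Ψ ⊗ T_a 𝟙_L =
Ψ ⊗ ρ_f(v̂_a) 𝟙_L` span `𝒮(𝔸_Fⁿ)` (`exists_level_of_mem_schwartzBruhat`, `exists_eq_sum_smul_finTranslateSB_indicatorSB`);
on them the archimedean factor decays locally uniformly (`IsArchFactor.of_continuous`) and the finite factor
`ρ_f(π(s h) v̂_a) 𝟙_L` is bounded by `1` and supported in `a + L` as soon as `((π(s h) v_a)_1)_f ∈ a + L` — an open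
condition holding at `h = 1` (`decay_generator`). Linearity (`decay_sum`, …, `decay_near_one`), translation
`ω(s h) = ω(s(h h₀⁻¹)) ω(s h₀)` (`decay_near`) and `HasThetaMajorants.of_decay` conclude. The intermediate lemmas are
stated for a continuous MULTIPLICATIVE map `s : H → Mp_ψ(W_𝔸)ᶜᵒⁿᵗ` (plain function; the final theorem takes `H →* _`).

Conventions: kernel only, 0 records, 0 sorry; axioms `propext, Classical.choice, Quot.sound`.
-/

noncomputable section

open scoped Matrix SchwartzMap TensorProduct Topology Classical

open NumberField NumberField.mixedEmbedding IsDedekindDomain Set Filter MeasureTheory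

namespace Literature.NumberTheory.Weil1964

open Literature.NumberTheory.Automorphic Literature.RepresentationTheory.HeisenbergGroup
open Literature.Analysis.SegalBargmann

variable {F : Type} [Field F] [NumberField F] {ι : Type} [Fintype ι]

/-! ## §1. The dual box of a compact open subgroup is compact and open -/

section DualBox

/-- **`L^♮` is compact** for `L` compact open: the finite Fourier transform of `𝟙_L` is `μ(L) 𝟙_{L^♮}`
(`finitePiFourier_indicator_addSubgroup`) and is a Schwartz–Bruhat function, so `L^♮` lies in its compact support.
[folklore] -/
theorem isCompact_dualBox (L : AddSubgroup (ι → FiniteAdeleRing (𝓞 F) F))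
    (hLo : IsOpen (L : Set (ι → FiniteAdeleRing (𝓞 F) F)))
    (hLc : IsCompact (L : Set (ι → FiniteAdeleRing (𝓞 F) F))) :
    IsCompact (dualBox F ι L : Set (ι → FiniteAdeleRing (𝓞 F) F)) := by
  haveI := secondCountableTopology_finiteAdeleRing (K := F)
  haveI := locallyCompactSpace_finiteAdeleRing' (K := F)
  letI : MeasurableSpace (FiniteAdeleRing (𝓞 F) F) := borel _
  haveI : BorelSpace (FiniteAdeleRing (𝓞 F) F) := ⟨rfl⟩
  haveI : BorelSpace (ι → FiniteAdeleRing (𝓞 F) F) := Pi.borelSpace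
  set μ : Measure (ι → FiniteAdeleRing (𝓞 F) F) := Measure.addHaar with hμ
  have hSB := finitePiFourier_mem_schwartzBruhat F μ (indicator_addSubgroup_mem_schwartzBruhat L hLo hLc 1)
  obtain ⟨-, hcs⟩ := (mem_schwartzBruhat_iff).1 hSB
  have hpos : μ.real (L : Set (ι → FiniteAdeleRing (𝓞 F) F)) ≠ 0 := by
    rw [measureReal_def, ENNReal.toReal_ne_zero]
    exact ⟨(hLo.measure_pos μ ⟨0, L.zero_mem⟩).ne', hLc.measure_lt_top.ne⟩
  refine hcs.of_isClosed_subset (isClosed_dualBox L) fun y hy => subset_tsupport _ ?_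
  rw [Function.mem_support, finitePiFourier_indicator_addSubgroup μ L hLo.measurableSet y,
    Set.indicator_of_mem hy, mul_one]
  exact_mod_cast hpos

/-- **`L^♮` is open** for `L` compact open: it is a fibre of the locally constant function `𝓕(𝟙_L) = μ(L) 𝟙_{L^♮}`.
[folklore] -/
theorem isOpen_dualBox (L : AddSubgroup (ι → FiniteAdeleRing (𝓞 F) F))
    (hLo : IsOpen (L : Set (ι → FiniteAdeleRing (𝓞 F) F)))
    (hLc : IsCompact (L : Set (ι → FiniteAdeleRing (𝓞 F) F))) :
    IsOpen (dualBox F ι L : Set (ι → FiniteAdeleRing (𝓞 F) F)) := by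
  haveI := secondCountableTopology_finiteAdeleRing (K := F)
  haveI := locallyCompactSpace_finiteAdeleRing' (K := F)
  letI : MeasurableSpace (FiniteAdeleRing (𝓞 F) F) := borel _
  haveI : BorelSpace (FiniteAdeleRing (𝓞 F) F) := ⟨rfl⟩
  haveI : BorelSpace (ι → FiniteAdeleRing (𝓞 F) F) := Pi.borelSpace
  set μ : Measure (ι → FiniteAdeleRing (𝓞 F) F) := Measure.addHaar with hμ
  have hlc := isLocallyConstant_finitePiFourier F μ (indicator_addSubgroup_mem_schwartzBruhat L hLo hLc 1)
  have hpos : μ.real (L : Set (ι → FiniteAdeleRing (𝓞 F) F)) ≠ 0 := by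
    rw [measureReal_def, ENNReal.toReal_ne_zero]
    exact ⟨(hLo.measure_pos μ ⟨0, L.zero_mem⟩).ne', hLc.measure_lt_top.ne⟩
  have heq : (dualBox F ι L : Set (ι → FiniteAdeleRing (𝓞 F) F)) =
      finitePiFourier F μ ((L : Set (ι → FiniteAdeleRing (𝓞 F) F)).indicator fun _ => (1 : ℂ)) ⁻¹'
        {(μ.real (L : Set (ι → FiniteAdeleRing (𝓞 F) F)) : ℂ)} := by
    ext y
    rw [Set.mem_preimage, Set.mem_singleton_iff, finitePiFourier_indicator_addSubgroup μ L hLo.measurableSet y]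
    by_cases hy : y ∈ dualBox F ι L
    · rw [Set.indicator_of_mem hy, mul_one]
      exact ⟨fun _ => rfl, fun _ => hy⟩
    · rw [Set.indicator_of_notMem hy, mul_zero]
      refine ⟨fun h => (hy h).elim, fun h => ?_⟩
      exact (hpos (by exact_mod_cast h.symm)).elim
  rw [heq]
  exact hlc.isOpen_fiber _

end DualBox

/-! ## §2. Finite Heisenberg elements fixing `𝟙_L`, and the joint continuity of the action -/

section Fixing

variable [DecidableEq ι] {T : Matrix ι ι (AdeleRing (𝓞 F) F)}

/-- **A Heisenberg element `((x, y), t)` fixes `𝟙_L`** as soon as `x_f ∈ L`, `(T y)_f ∈ L^♮` and `ψ(t) = 1`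
(the pointwise formula `coe_finSchrodinger_apply`). [folklore] -/
theorem finSchrodinger_indicatorSB_eq_self (L : AddSubgroup (ι → FiniteAdeleRing (𝓞 F) F))
    (hLo : IsOpen (L : Set (ι → FiniteAdeleRing (𝓞 F) F)))
    (hLc : IsCompact (L : Set (ι → FiniteAdeleRing (𝓞 F) F))) {h : AdelicHeisenberg F ι T}
    (h1 : piFinite F ι h.v.1 ∈ L) (h2 : piFinite F ι (T *ᵥ h.v.2) ∈ dualBox F ι L)
    (h3 : adeleAddChar F h.t = 1) :
    finSchrodinger T h (indicatorSB F ι L hLo hLc) = indicatorSB F ι L hLo hLc := by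
  apply Subtype.ext
  funext b
  rw [coe_finSchrodinger_apply, coe_indicatorSB, h3, Circle.coe_one, one_mul]
  by_cases hb : b ∈ L
  · have hb' : piFinite F ι h.v.1 + b ∈ (L : Set (ι → FiniteAdeleRing (𝓞 F) F)) := L.add_mem h1 hb
    rw [Set.indicator_of_mem hb', Set.indicator_of_mem (show b ∈ (L : Set _) from hb), mul_one,
      (mem_dualBox_iff (K := F)).1 h2 b hb, Circle.coe_one]
  · have hb' : piFinite F ι h.v.1 + b ∉ (L : Set (ι → FiniteAdeleRing (𝓞 F) F)) := fun hmem =>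
      hb (by simpa using L.sub_mem hmem h1)
    rw [Set.indicator_of_notMem hb', Set.indicator_of_notMem (show b ∉ (L : Set _) from hb), mul_zero]


/-- `ψ(t) = 1` for an adele `t` with zero archimedean component and integral finite component. [folklore] -/
theorem adeleAddChar_eq_one_of_fst_eq_zero {t : AdeleRing (𝓞 F) F} (h1 : t.1 = 0)
    (h2 : t.2 ∈ integralFiniteAdeles F) : adeleAddChar F t = 1 := by
  rw [show t = ((0 : InfiniteAdeleRing F), t.2) from Prod.ext h1 rfl, ← finiteAdeleAddChar_apply]
  exact finiteAdeleAddChar_eq_one_of_forall_mem F ((mem_integralFiniteAdeles_iff).1 h2)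

/-- The archimedean component of `B(e_f • a, b)` vanishes (`e_f` the finite idempotent). [folklore] -/
theorem fst_polar_adelicForm_finIdem_smul (a b : (ι → AdeleRing (𝓞 F) F) × (ι → AdeleRing (𝓞 F) F)) :
    (polar (adelicForm F ι T) (finIdem F • a) b).1 = 0 := by
  rw [LinearMap.map_smul₂, smul_eq_mul, finIdem_mul]

/-- **Joint continuity of an orbit-continuous family of symplectic automorphisms**: if every orbit map
`z ↦ g(z) w` is continuous then `(z, w) ↦ g(z) w` is continuous (expand `w` in the standard `𝔸_F`-basis of
`W = 𝔸_F^ι × 𝔸_F^ι`). [folklore] -/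
theorem continuous_symplectic_apply₂ {Z : Type*} [TopologicalSpace Z]
    {g : Z → symplecticGroup (polar (adelicForm F ι T))}
    (hg : ∀ w, Continuous fun z => ((g z : symplecticGroup (polar (adelicForm F ι T))) :
      ((ι → AdeleRing (𝓞 F) F) × (ι → AdeleRing (𝓞 F) F)) ≃ₗ[AdeleRing (𝓞 F) F]
        ((ι → AdeleRing (𝓞 F) F) × (ι → AdeleRing (𝓞 F) F))) w) :
    Continuous fun p : Z × ((ι → AdeleRing (𝓞 F) F) × (ι → AdeleRing (𝓞 F) F)) =>
      ((g p.1 : symplecticGroup (polar (adelicForm F ι T))) :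
        ((ι → AdeleRing (𝓞 F) F) × (ι → AdeleRing (𝓞 F) F)) ≃ₗ[AdeleRing (𝓞 F) F]
          ((ι → AdeleRing (𝓞 F) F) × (ι → AdeleRing (𝓞 F) F))) p.2 := by
  have hexp : ∀ w : (ι → AdeleRing (𝓞 F) F) × (ι → AdeleRing (𝓞 F) F),
      w = ∑ i, (w.1 i) • ((Pi.single i 1, 0) : (ι → AdeleRing (𝓞 F) F) × (ι → AdeleRing (𝓞 F) F)) +
        ∑ i, (w.2 i) • ((0, Pi.single i 1) : (ι → AdeleRing (𝓞 F) F) × (ι → AdeleRing (𝓞 F) F)) := by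
    intro w
    refine Prod.ext ?_ ?_
    · rw [Prod.fst_add, Prod.fst_sum, Prod.fst_sum]
      funext j
      simp only [Prod.smul_fst, smul_zero, Finset.sum_const_zero, Pi.add_apply, Pi.zero_apply, add_zero,
        Finset.sum_apply, Pi.smul_apply, Pi.single_apply, smul_eq_mul, mul_ite, mul_one, mul_zero,
        Finset.sum_ite_eq, Finset.mem_univ, if_true]
    · rw [Prod.snd_add, Prod.snd_sum, Prod.snd_sum]
      funext j
      simp only [Prod.smul_snd, smul_zero, Finset.sum_const_zero, Pi.add_apply, Pi.zero_apply, zero_add,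
        Finset.sum_apply, Pi.smul_apply, Pi.single_apply, smul_eq_mul, mul_ite, mul_one, mul_zero,
        Finset.sum_ite_eq, Finset.mem_univ, if_true]
  have heq : (fun p : Z × ((ι → AdeleRing (𝓞 F) F) × (ι → AdeleRing (𝓞 F) F)) =>
      ((g p.1 : symplecticGroup (polar (adelicForm F ι T))) :
        ((ι → AdeleRing (𝓞 F) F) × (ι → AdeleRing (𝓞 F) F)) ≃ₗ[AdeleRing (𝓞 F) F]
          ((ι → AdeleRing (𝓞 F) F) × (ι → AdeleRing (𝓞 F) F))) p.2) =
      fun p => ∑ i, (p.2.1 i) • ((g p.1 : symplecticGroup (polar (adelicForm F ι T))) :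
          ((ι → AdeleRing (𝓞 F) F) × (ι → AdeleRing (𝓞 F) F)) ≃ₗ[AdeleRing (𝓞 F) F]
            ((ι → AdeleRing (𝓞 F) F) × (ι → AdeleRing (𝓞 F) F))) (Pi.single i 1, 0) +
        ∑ i, (p.2.2 i) • ((g p.1 : symplecticGroup (polar (adelicForm F ι T))) :
          ((ι → AdeleRing (𝓞 F) F) × (ι → AdeleRing (𝓞 F) F)) ≃ₗ[AdeleRing (𝓞 F) F]
            ((ι → AdeleRing (𝓞 F) F) × (ι → AdeleRing (𝓞 F) F))) (0, Pi.single i 1) := by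
    funext p
    conv_lhs => rw [hexp p.2]
    simp only [map_add, map_sum, map_smul]
  rw [heq]
  exact (continuous_finsetSum _ fun i _ =>
      ((continuous_apply i).comp (continuous_fst.comp continuous_snd)).smul ((hg _).comp continuous_fst)).add
    (continuous_finsetSum _ fun i _ =>
      ((continuous_apply i).comp (continuous_snd.comp continuous_snd)).smul ((hg _).comp continuous_fst))

/-- Components of `g · v̂` for a symplectic `g` and the Heisenberg element `v̂ = (v, 0)`. [folklore] -/
theorem act_ofVec_v (g : symplecticGroup (polar (adelicForm F ι T)))
    (v : (ι → AdeleRing (𝓞 F) F) × (ι → AdeleRing (𝓞 F) F)) :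
    ((ofSymplectic (polar (adelicForm F ι T)) g).act (Heisenberg.ofVec (polar (adelicForm F ι T)) v)).v =
      (g : ((ι → AdeleRing (𝓞 F) F) × (ι → AdeleRing (𝓞 F) F)) ≃ₗ[AdeleRing (𝓞 F) F]
        ((ι → AdeleRing (𝓞 F) F) × (ι → AdeleRing (𝓞 F) F))) v := by
  rw [Heisenberg.PseudoSymplectic.act_v, ofSymplectic_σ, Heisenberg.ofVec_v]

/-- Central component of `g · v̂`: `½ (B(gv, gv) - B(v, v))`. [folklore] -/
theorem act_ofVec_t (g : symplecticGroup (polar (adelicForm F ι T)))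
    (v : (ι → AdeleRing (𝓞 F) F) × (ι → AdeleRing (𝓞 F) F)) :
    ((ofSymplectic (polar (adelicForm F ι T)) g).act (Heisenberg.ofVec (polar (adelicForm F ι T)) v)).t =
      ⅟(2 : AdeleRing (𝓞 F) F) *
        (polar (adelicForm F ι T)
            ((g : ((ι → AdeleRing (𝓞 F) F) × (ι → AdeleRing (𝓞 F) F)) ≃ₗ[AdeleRing (𝓞 F) F]
              ((ι → AdeleRing (𝓞 F) F) × (ι → AdeleRing (𝓞 F) F))) v)
            ((g : ((ι → AdeleRing (𝓞 F) F) × (ι → AdeleRing (𝓞 F) F)) ≃ₗ[AdeleRing (𝓞 F) F]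
              ((ι → AdeleRing (𝓞 F) F) × (ι → AdeleRing (𝓞 F) F))) v) -
          polar (adelicForm F ι T) v v) := by
  rw [Heisenberg.PseudoSymplectic.act_t, Heisenberg.ofVec_t, Heisenberg.ofVec_v, zero_add, ofSymplectic_f]

/-- **Eventual fixing, uniformly on a compact parameter set.** Let `g : Z → Sp(W_𝔸)` be orbit-continuous with
`g(z₀) = 1`, and let `v : P → W_𝔸` be a continuous family of FINITE vectors (`e_f • v = v`), `K ⊆ P` compact, such
that every `v̂(p)`, `p ∈ K`, fixes `𝟙_L` through the three conditions of `finSchrodinger_indicatorSB_eq_self`.  Then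
for `z` near `z₀`, every `g(z) · v̂(p)`, `p ∈ K`, still fixes `𝟙_L` (the three conditions are open and jointly
continuous in `(z, p)`; tube lemma). [folklore] -/
theorem eventually_forall_finSchrodinger_act_indicatorSB {Z P : Type*} [TopologicalSpace Z] [TopologicalSpace P]
    {z₀ : Z} {g : Z → symplecticGroup (polar (adelicForm F ι T))}
    (hg : ∀ w, Continuous fun z => ((g z : symplecticGroup (polar (adelicForm F ι T))) :
      ((ι → AdeleRing (𝓞 F) F) × (ι → AdeleRing (𝓞 F) F)) ≃ₗ[AdeleRing (𝓞 F) F]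
        ((ι → AdeleRing (𝓞 F) F) × (ι → AdeleRing (𝓞 F) F))) w)
    (h0 : g z₀ = 1) {v : P → (ι → AdeleRing (𝓞 F) F) × (ι → AdeleRing (𝓞 F) F)} (hv : Continuous v)
    (hvf : ∀ p, finIdem F • v p = v p) {K : Set P} (hK : IsCompact K)
    (L : AddSubgroup (ι → FiniteAdeleRing (𝓞 F) F)) (hLo : IsOpen (L : Set (ι → FiniteAdeleRing (𝓞 F) F)))
    (hLc : IsCompact (L : Set (ι → FiniteAdeleRing (𝓞 F) F)))
    (hK1 : ∀ p ∈ K, piFinite F ι (v p).1 ∈ L) (hK2 : ∀ p ∈ K, piFinite F ι (T *ᵥ (v p).2) ∈ dualBox F ι L)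
    (hK3 : ∀ p ∈ K, polar (adelicForm F ι T) (v p) (v p) = 0) :
    ∀ᶠ z in 𝓝 z₀, ∀ p ∈ K,
      finSchrodinger T ((ofSymplectic (polar (adelicForm F ι T)) (g z)).act
          (Heisenberg.ofVec (polar (adelicForm F ι T)) (v p))) (indicatorSB F ι L hLo hLc) =
        indicatorSB F ι L hLo hLc := by
  -- the moved vector `V z p = g(z) v(p)`, jointly continuous
  set V : Z → P → (ι → AdeleRing (𝓞 F) F) × (ι → AdeleRing (𝓞 F) F) := fun z p =>
    ((g z : symplecticGroup (polar (adelicForm F ι T))) :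
      ((ι → AdeleRing (𝓞 F) F) × (ι → AdeleRing (𝓞 F) F)) ≃ₗ[AdeleRing (𝓞 F) F]
        ((ι → AdeleRing (𝓞 F) F) × (ι → AdeleRing (𝓞 F) F))) (v p) with hVdef
  have hVc : Continuous fun q : Z × P => V q.1 q.2 :=
    (continuous_symplectic_apply₂ hg).comp (continuous_fst.prodMk (hv.comp continuous_snd))
  have hV0 : ∀ p, V z₀ p = v p := fun p => by
    simp only [hVdef, h0]
    rfl
  -- the three condition maps
  have hc1 : Continuous fun q : Z × P => piFinite F ι (V q.1 q.2).1 :=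
    continuous_piFinite.comp (continuous_fst.comp hVc)
  have hc2 : Continuous fun q : Z × P => piFinite F ι (T *ᵥ (V q.1 q.2).2) :=
    continuous_piFinite.comp (continuous_const.matrix_mulVec (continuous_snd.comp hVc))
  have hB : Continuous fun w : (ι → AdeleRing (𝓞 F) F) × (ι → AdeleRing (𝓞 F) F) =>
      polar (adelicForm F ι T) w w := by
    have h : (fun w : (ι → AdeleRing (𝓞 F) F) × (ι → AdeleRing (𝓞 F) F) => polar (adelicForm F ι T) w w) =
        fun w => w.1 ⬝ᵥ (T *ᵥ w.2) := by
      funext w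
      rw [polar_apply, adelicForm_apply]
    rw [h]
    exact continuous_fst.dotProduct (continuous_const.matrix_mulVec continuous_snd)
  have hc3 : Continuous fun q : Z × P =>
      (⅟(2 : AdeleRing (𝓞 F) F) * (polar (adelicForm F ι T) (V q.1 q.2) (V q.1 q.2) -
        polar (adelicForm F ι T) (v q.2) (v q.2))).2 :=
    continuous_snd.comp (continuous_const.mul ((hB.comp hVc).sub (hB.comp (hv.comp continuous_snd))))
  -- eventually, near `(z₀, p)` for each `p ∈ K`
  have hev : ∀ p ∈ K, ∀ᶠ q : Z × P in 𝓝 (z₀, p),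
      (fun z p => piFinite F ι (V z p).1 ∈ (L : Set (ι → FiniteAdeleRing (𝓞 F) F)) ∧
        piFinite F ι (T *ᵥ (V z p).2) ∈ (dualBox F ι L : Set (ι → FiniteAdeleRing (𝓞 F) F)) ∧
          (⅟(2 : AdeleRing (𝓞 F) F) * (polar (adelicForm F ι T) (V z p) (V z p) -
            polar (adelicForm F ι T) (v p) (v p))).2 ∈
              (integralFiniteAdeles F : Set (FiniteAdeleRing (𝓞 F) F))) q.1 q.2 := by
    intro p hp
    refine (hc1.continuousAt.eventually_mem (hLo.mem_nhds ?_)).and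
      ((hc2.continuousAt.eventually_mem ((isOpen_dualBox L hLo hLc).mem_nhds ?_)).and
        (hc3.continuousAt.eventually_mem ((isOpen_integralFiniteAdeles F).mem_nhds ?_)))
    · show piFinite F ι (V z₀ p).1 ∈ (L : Set (ι → FiniteAdeleRing (𝓞 F) F))
      rw [hV0]
      exact hK1 p hp
    · show piFinite F ι (T *ᵥ (V z₀ p).2) ∈ (dualBox F ι L : Set (ι → FiniteAdeleRing (𝓞 F) F))
      rw [hV0]
      exact hK2 p hp
    · show (⅟(2 : AdeleRing (𝓞 F) F) * (polar (adelicForm F ι T) (V z₀ p) (V z₀ p) -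
        polar (adelicForm F ι T) (v p) (v p))).2 ∈ (integralFiniteAdeles F : Set (FiniteAdeleRing (𝓞 F) F))
      rw [hV0, sub_self, mul_zero]
      exact zero_mem _
  have key := hK.eventually_forall_of_forall_eventually (x₀ := z₀)
    (P := fun z p => piFinite F ι (V z p).1 ∈ (L : Set (ι → FiniteAdeleRing (𝓞 F) F)) ∧
        piFinite F ι (T *ᵥ (V z p).2) ∈ (dualBox F ι L : Set (ι → FiniteAdeleRing (𝓞 F) F)) ∧
          (⅟(2 : AdeleRing (𝓞 F) F) * (polar (adelicForm F ι T) (V z p) (V z p) -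
            polar (adelicForm F ι T) (v p) (v p))).2 ∈
              (integralFiniteAdeles F : Set (FiniteAdeleRing (𝓞 F) F))) hev
  filter_upwards [key] with z hz p hp
  obtain ⟨h1, h2, h3⟩ := hz p hp
  have hfin : finIdem F • V z p = V z p := by
    simp only [hVdef]
    rw [← map_smul, hvf]
  refine finSchrodinger_indicatorSB_eq_self L hLo hLc ?_ ?_ ?_
  · rw [act_ofVec_v]
    exact h1
  · rw [act_ofVec_v]
    exact h2
  · rw [act_ofVec_t]
    refine adeleAddChar_eq_one_of_fst_eq_zero ?_ ?_
    · have h := fst_polar_adelicForm_finIdem_smul (T := T) (V z p) (V z p)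
      rw [hfin] at h
      rw [hK3 p hp, sub_zero, show (⅟(2 : AdeleRing (𝓞 F) F) * polar (adelicForm F ι T) (V z p) (V z p)).1 =
        (⅟(2 : AdeleRing (𝓞 F) F)).1 * (polar (adelicForm F ι T) (V z p) (V z p)).1 from rfl, h, mul_zero]
    · exact h3

end Fixing

/-! ## §3. One-factor archimedean Schur: two covariant operators are proportional -/

section ArchSchur

variable [DecidableEq ι] (T : Matrix ι ι (AdeleRing (𝓞 F) F))

/-- An operator commuting with all archimedean Heisenberg operators `archModTrans T a w` commutes with all Folland
operators `rhoSD e p q` (for `T_∞` invertible the Folland coordinates are onto, `archFolland_bijective`).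
[folklore] -/
theorem commute_rhoSD_of_commute_archModTrans {σ : Type*} [Fintype σ] [DecidableEq σ]
    (e : (ι → mixedSpace F) ≃L[ℝ] (σ → ℝ)) (hT : IsUnit (archMat F ι T))
    (R : 𝓢((ι → mixedSpace F), ℂ) →L[ℂ] 𝓢((ι → mixedSpace F), ℂ))
    (hR : ∀ (a w : ι → mixedSpace F) (Φ : 𝓢((ι → mixedSpace F), ℂ)),
      R (archModTrans F ι T a w Φ) = archModTrans F ι T a w (R Φ))
    (p q : σ → ℝ) (Φ : 𝓢((ι → mixedSpace F), ℂ)) : R (rhoSD e p q Φ) = rhoSD e p q (R Φ) := by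
  obtain ⟨⟨a, w⟩, haw⟩ := (archFolland_bijective T e hT).2 (p, q)
  have hp := congrArg Prod.fst haw
  have hq := congrArg Prod.snd haw
  simp only [archFolland_fst, archFolland_snd] at hp hq
  subst hp
  subst hq
  have h := hR a w Φ
  rw [archModTrans_eq_smul_rhoSD T e, archModTrans_eq_smul_rhoSD T e, map_smul] at h
  exact smul_right_injective _ (Complex.exp_ne_zero _) h

/-- **One-factor Schur for the archimedean Weil operators.** Two operators on `𝒮(F_∞^ι)`, one of them invertible,
both covariant over the archimedean Heisenberg operators with the SAME Weil phase of `g ∈ Sp(W_𝔸)` (the conclusion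
shape of `arch_covariant_of_implements`), are proportional: `A⁻¹ ∘ W` commutes with the irreducible Heisenberg action,
so it is a scalar (`eq_smul_of_commute_rhoSD`). [cite: Folland1989, Prop. (1.43)] -/
theorem exists_eq_smul_of_archModTrans_covariant (hT : IsUnit (archMat F ι T))
    (g : symplecticGroup (polar (adelicForm F ι T)))
    (A : 𝓢((ι → mixedSpace F), ℂ) ≃L[ℂ] 𝓢((ι → mixedSpace F), ℂ))
    (W : 𝓢((ι → mixedSpace F), ℂ) →L[ℂ] 𝓢((ι → mixedSpace F), ℂ))
    (hA : ∀ (a w : ι → mixedSpace F) (Φ : 𝓢((ι → mixedSpace F), ℂ)), A (archModTrans F ι T a w Φ) =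
      weilPhase T g (a, w) • archModTrans F ι T (archAct T g (a, w)).1 (archAct T g (a, w)).2 (A Φ))
    (hW : ∀ (a w : ι → mixedSpace F) (Φ : 𝓢((ι → mixedSpace F), ℂ)), W (archModTrans F ι T a w Φ) =
      weilPhase T g (a, w) • archModTrans F ι T (archAct T g (a, w)).1 (archAct T g (a, w)).2 (W Φ)) :
    ∃ c : ℂ, ∀ Φ, W Φ = c • A Φ := by
  set e : (ι → mixedSpace F) ≃L[ℝ] (Fin (Module.finrank ℝ (ι → mixedSpace F)) → ℝ) :=
    ContinuousLinearEquiv.ofFinrankEq (Module.finrank_fin_fun ℝ).symm with he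
  set R : 𝓢((ι → mixedSpace F), ℂ) →L[ℂ] 𝓢((ι → mixedSpace F), ℂ) :=
    (A.symm : 𝓢((ι → mixedSpace F), ℂ) →L[ℂ] 𝓢((ι → mixedSpace F), ℂ)).comp W with hRdef
  have hR : ∀ (a w : ι → mixedSpace F) (Φ : 𝓢((ι → mixedSpace F), ℂ)),
      R (archModTrans F ι T a w Φ) = archModTrans F ι T a w (R Φ) := by
    intro a w Φ
    show A.symm (W (archModTrans F ι T a w Φ)) = archModTrans F ι T a w (A.symm (W Φ))
    have h2 := hA a w (A.symm (W Φ))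
    rw [ContinuousLinearEquiv.apply_symm_apply] at h2
    rw [hW, ← h2, ContinuousLinearEquiv.symm_apply_apply]
  obtain ⟨c, hc⟩ := eq_smul_of_commute_rhoSD e R (commute_rhoSD_of_commute_archModTrans T e hT R hR)
  refine ⟨c, fun Φ => ?_⟩
  have h : A.symm (W Φ) = c • Φ := hc Φ
  calc W Φ = A (A.symm (W Φ)) := (A.apply_symm_apply _).symm
    _ = c • A Φ := by rw [h, map_smul]

end ArchSchur

/-! ## §4. The normalised factors of `ω(q)` against a given archimedean operator -/

section Factors

variable [DecidableEq ι] {T : Matrix ι ι (AdeleRing (𝓞 F) F)}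

/-- **Stripping and normalisation.** For `q ∈ Mp_ψ(W_𝔸)ᶜᵒⁿᵗ` and a non-zero operator `W` on `𝒮(F_∞^ι)` covariant
with the Weil phase of `π(q)`: `ω(q)(Ψ ⊗ φ) = (c W Ψ) ⊗ M_f φ` on pure tensors, with `c ≠ 0` and `M_f` a finite
implementer of `π(q)` (a linear map on `𝒮((𝔸_{F,f})^ι)`) (from `exists_finImplementer`, `exists_continuousLinearEquiv_of_mem_adelicMpCont`,
`arch_covariant_of_implements` and the one-factor Schur lemma). [cite: MoeglinVignerasWaldspurger1987, Chap. 2 II.1 (A)] -/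
theorem exists_factors_of_archModTrans_covariant (hT : IsUnit T) (q : adelicMpCont F ι T)
    (W : 𝓢((ι → mixedSpace F), ℂ) →L[ℂ] 𝓢((ι → mixedSpace F), ℂ)) (hW0 : W ≠ 0)
    (hW : ∀ (a w : ι → mixedSpace F) (Φ : 𝓢((ι → mixedSpace F), ℂ)), W (archModTrans F ι T a w Φ) =
      weilPhase T (adelicMpCont.proj F ι T q) (a, w) •
        archModTrans F ι T (archAct T (adelicMpCont.proj F ι T q) (a, w)).1
          (archAct T (adelicMpCont.proj F ι T q) (a, w)).2 (W Φ)) :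
    ∃ (c : ℂ) (B : FinSB F ι →ₗ[ℂ] FinSB F ι), c ≠ 0 ∧
      (∀ h ∈ finHeisenberg T, ∀ Φ : piSchwartzBruhat F ι,
        adelicTensorEnd LinearMap.id B (adelicSchrodinger F ι T h Φ) =
          adelicSchrodinger F ι T ((ofSymplectic (polar (adelicForm F ι T)) (adelicMpCont.proj F ι T q)).act h)
            (adelicTensorEnd LinearMap.id B Φ)) ∧
      ∀ (Ψ : 𝓢((ι → mixedSpace F), ℂ)) (φ : FinSB F ι),
        adelicMpCont.omega F ι T q (piSchwartzBruhatEquiv F ι (Ψ ⊗ₜ φ)) =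
          piSchwartzBruhatEquiv F ι ((c • W Ψ) ⊗ₜ B φ) := by
  have hsurj : Function.Surjective fun y : ι → AdeleRing (𝓞 F) F => T *ᵥ y := mulVec_surjective_of_isUnit hT
  have homega : ∀ Φ, adelicMpCont.omega F ι T q Φ = ((q : adelicMp F ι T) :
      symplecticGroup (polar (adelicForm F ι T)) × (piSchwartzBruhat F ι ≃ₗ[ℂ] piSchwartzBruhat F ι)).2 Φ :=
    fun Φ => by rw [adelicMpCont.omega_apply, omegaPsi_apply]
  have hM : Implements (adelicSchrodinger F ι T)
      (ofSymplectic (polar (adelicForm F ι T)) (adelicMpCont.proj F ι T q)) ((q : adelicMp F ι T) :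
        symplecticGroup (polar (adelicForm F ι T)) × (piSchwartzBruhat F ι ≃ₗ[ℂ] piSchwartzBruhat F ι)).2 :=
    (mem_MpPsi _ _).1 (q : adelicMp F ι T).2
  have hexf := exists_finImplementer hsurj (q : adelicMp F ι T)
  rcases hexf with ⟨Mf, hMf⟩
  have hexA := exists_continuousLinearEquiv_of_mem_adelicMpCont hsurj (q : adelicMp F ι T) q.2 Mf hMf
  rcases hexA with ⟨A, hA, -⟩
  have hAM := apply_piSchwartzBruhatEquiv_tmul_of_eq_adelicTensorEnd hA
  have hf₀ : (Mf : FinSB F ι →ₗ[ℂ] FinSB F ι)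
      (indicatorSB F ι (piLevelIdeal F ι ⊤) (isOpen_piLevelIdeal F ⊤) (isCompact_piLevelIdeal F ι ⊤)) ≠ 0 := by
    rw [LinearEquiv.coe_coe, Mf.map_ne_zero_iff]
    exact indicatorSB_top_ne_zero
  have hAcov := fun a w Φ => arch_covariant_of_implements T (adelicMpCont.proj F ι T q) _ hM _ _ hAM hf₀ a w Φ
  have hexc := exists_eq_smul_of_archModTrans_covariant T (isUnit_archMat_of_isUnit T hT)
    (adelicMpCont.proj F ι T q) A W hAcov hW
  rcases hexc with ⟨c, hc⟩
  have hc0 : c ≠ 0 := by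
    rintro rfl
    apply hW0
    ext Φ x
    rw [hc Φ, zero_smul]
    rfl
  refine ⟨c⁻¹, (Mf : FinSB F ι →ₗ[ℂ] FinSB F ι), inv_ne_zero hc0, hMf, fun Ψ φ => ?_⟩
  rw [homega, hAM, hc Ψ, smul_smul, inv_mul_cancel₀ hc0, one_smul]
  rfl

end Factors

/-! ## §5. Rigidity of the finite implementers near `h = 1` -/

section Rigidity

variable [DecidableEq ι] {T : Matrix ι ι (AdeleRing (𝓞 F) F)}

/-- `g (g' η) = η` when `g g' = 1`, for the action of `Sp(W_𝔸)` on the Heisenberg group. [folklore] -/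
theorem act_act_of_mul_eq_one {g g' : symplecticGroup (polar (adelicForm F ι T))} (hinv : g * g' = 1)
    (η : AdelicHeisenberg F ι T) :
    (ofSymplectic (polar (adelicForm F ι T)) g).act ((ofSymplectic (polar (adelicForm F ι T)) g').act η) =
      η := by
  rw [← Heisenberg.PseudoSymplectic.act_mul_act, ← map_mul, hinv, map_one, Heisenberg.PseudoSymplectic.act_one]

/-- **Lattice rigidity (pointwise).** If `M_f` is a finite implementer of `g` and `g⁻¹` moves the translations by
`L` and the modulations by `L^♮` to Heisenberg elements still fixing `𝟙_L`, then `M_f 𝟙_L` is fixed by all these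
translations and modulations, so `M_f 𝟙_L = (M_f 𝟙_L)(0) • 𝟙_L` (`eq_smul_indicatorSB_of_fixed`). [folklore] -/
theorem implementer_indicatorSB_eq_smul (hT : IsUnit T) (L : AddSubgroup (ι → FiniteAdeleRing (𝓞 F) F))
    (hLo : IsOpen (L : Set (ι → FiniteAdeleRing (𝓞 F) F)))
    (hLc : IsCompact (L : Set (ι → FiniteAdeleRing (𝓞 F) F)))
    {g g' : symplecticGroup (polar (adelicForm F ι T))} (hinv : g * g' = 1) {Mf : FinSB F ι →ₗ[ℂ] FinSB F ι}
    (hMf : ∀ h ∈ finHeisenberg T, ∀ Φ : piSchwartzBruhat F ι,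
      adelicTensorEnd LinearMap.id Mf (adelicSchrodinger F ι T h Φ) =
        adelicSchrodinger F ι T ((ofSymplectic (polar (adelicForm F ι T)) g).act h)
          (adelicTensorEnd LinearMap.id Mf Φ))
    (h1 : ∀ l ∈ L, finSchrodinger T ((ofSymplectic (polar (adelicForm F ι T)) g').act
      (Heisenberg.ofVec (polar (adelicForm F ι T)) (piAdeleSplit F ι (0, l), 0))) (indicatorSB F ι L hLo hLc) =
        indicatorSB F ι L hLo hLc)
    (h2 : ∀ y ∈ dualBox F ι L, finSchrodinger T ((ofSymplectic (polar (adelicForm F ι T)) g').act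
      (Heisenberg.ofVec (polar (adelicForm F ι T))
        (0, ((hT.unit⁻¹ : (Matrix ι ι (AdeleRing (𝓞 F) F))ˣ) : Matrix ι ι (AdeleRing (𝓞 F) F)) *ᵥ
          piAdeleSplit F ι (0, y)))) (indicatorSB F ι L hLo hLc) = indicatorSB F ι L hLo hLc) :
    Mf (indicatorSB F ι L hLo hLc) =
      ((Mf (indicatorSB F ι L hLo hLc) : FinSB F ι) : (ι → FiniteAdeleRing (𝓞 F) F) → ℂ) 0 •
        indicatorSB F ι L hLo hLc := by
  -- `ρ_f(g η) (M_f 𝟙_L) = M_f (ρ_f(η) 𝟙_L) = M_f 𝟙_L` for finite `η` fixing `𝟙_L`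
  have key : ∀ {η : AdelicHeisenberg F ι T}, η ∈ finHeisenberg T →
      finSchrodinger T η (indicatorSB F ι L hLo hLc) = indicatorSB F ι L hLo hLc →
      finSchrodinger T ((ofSymplectic (polar (adelicForm F ι T)) g).act η) (Mf (indicatorSB F ι L hLo hLc)) =
        Mf (indicatorSB F ι L hLo hLc) := by
    intro η hη hfix
    have h := LinearMap.congr_fun (comp_finSchrodinger_of_finImplementer hMf hη) (indicatorSB F ι L hLo hLc)
    rw [LinearMap.comp_apply, LinearMap.comp_apply, hfix] at h
    exact h.symm
  refine eq_smul_indicatorSB_of_fixed L hLo hLc (fun l hl => ?_) (fun y hy => ?_)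
  · have h := key (act_mem_finHeisenberg _ (ofVec_mem_finHeisenberg (T := T)
      (finIdem_smul_piAdeleSplit_zero l) (smul_zero _))) (h1 l hl)
    rwa [act_act_of_mul_eq_one hinv, finSchrodinger_ofVec_inl] at h
  · have hy' : T *ᵥ (((hT.unit⁻¹ : (Matrix ι ι (AdeleRing (𝓞 F) F))ˣ) : Matrix ι ι (AdeleRing (𝓞 F) F)) *ᵥ
        piAdeleSplit F ι (0, y)) = piAdeleSplit F ι (0, y) := by
      rw [Matrix.mulVec_mulVec, hT.mul_val_inv, Matrix.one_mulVec]
    have hfin : finIdem F • (((hT.unit⁻¹ : (Matrix ι ι (AdeleRing (𝓞 F) F))ˣ) :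
        Matrix ι ι (AdeleRing (𝓞 F) F)) *ᵥ piAdeleSplit F ι (0, y)) =
        ((hT.unit⁻¹ : (Matrix ι ι (AdeleRing (𝓞 F) F))ˣ) : Matrix ι ι (AdeleRing (𝓞 F) F)) *ᵥ
          piAdeleSplit F ι (0, y) := by
      rw [← Matrix.mulVec_smul, finIdem_smul_piAdeleSplit_zero]
    have h := key (act_mem_finHeisenberg _ (ofVec_mem_finHeisenberg (T := T) (smul_zero _) hfin)) (h2 y hy)
    rwa [act_act_of_mul_eq_one hinv, finSchrodinger_ofVec_inr T hy'] at h

omit [Fintype ι] [DecidableEq ι] in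
/-- `(0)_f = 0`. [folklore] -/
theorem piFinite_zero_vec : piFinite F ι (0 : ι → AdeleRing (𝓞 F) F) = 0 := funext fun _ => rfl

variable {H : Type*} [Group H] [TopologicalSpace H] [IsTopologicalGroup H]

/-- **Lattice rigidity near `1`.** For a continuous `s : H → Mp_ψ(W_𝔸)ᶜᵒⁿᵗ` with `s 1 = 1`,
`s(h) s(h⁻¹) = 1` (e.g. a continuous homomorphism) and a compact open
subgroup `L`: for `h` near `1`, EVERY finite implementer `M_f` of `π(s h)` satisfies `M_f 𝟙_L = (M_f 𝟙_L)(0) 𝟙_L`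
(the translations by the compact `L` and the modulations by the compact `L^♮`, moved by `π(s h)⁻¹ → 1`, still
fix `𝟙_L`: `eventually_forall_finSchrodinger_act_indicatorSB`). [folklore] -/
theorem eventually_implementer_indicatorSB_eq_smul (hT : IsUnit T) (s : H → adelicMpCont F ι T)
    (hs : Continuous s) (hs1 : s 1 = 1) (hsinv : ∀ h : H, s h * s h⁻¹ = 1)
    (L : AddSubgroup (ι → FiniteAdeleRing (𝓞 F) F))
    (hLo : IsOpen (L : Set (ι → FiniteAdeleRing (𝓞 F) F)))
    (hLc : IsCompact (L : Set (ι → FiniteAdeleRing (𝓞 F) F))) :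
    ∀ᶠ h in 𝓝 (1 : H), ∀ Mf : FinSB F ι →ₗ[ℂ] FinSB F ι,
      (∀ η ∈ finHeisenberg T, ∀ Φ : piSchwartzBruhat F ι,
        adelicTensorEnd LinearMap.id Mf (adelicSchrodinger F ι T η Φ) =
          adelicSchrodinger F ι T
            ((ofSymplectic (polar (adelicForm F ι T)) (adelicMpCont.proj F ι T (s h))).act η)
            (adelicTensorEnd LinearMap.id Mf Φ)) →
      Mf (indicatorSB F ι L hLo hLc) =
        ((Mf (indicatorSB F ι L hLo hLc) : FinSB F ι) : (ι → FiniteAdeleRing (𝓞 F) F) → ℂ) 0 •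
          indicatorSB F ι L hLo hLc := by
  -- the family `z ↦ π(s z⁻¹)` is orbit-continuous with value `1` at `z = 1`
  have hg : ∀ w : (ι → AdeleRing (𝓞 F) F) × (ι → AdeleRing (𝓞 F) F), Continuous fun z : H =>
      ((adelicMpCont.proj F ι T (s z⁻¹) : symplecticGroup (polar (adelicForm F ι T))) :
        ((ι → AdeleRing (𝓞 F) F) × (ι → AdeleRing (𝓞 F) F)) ≃ₗ[AdeleRing (𝓞 F) F]
          ((ι → AdeleRing (𝓞 F) F) × (ι → AdeleRing (𝓞 F) F))) w :=
    fun w => (adelicMpCont.continuous_proj_apply w).comp (hs.comp continuous_inv)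
  have h0 : adelicMpCont.proj F ι T (s (1 : H)⁻¹) = 1 := by simp only [inv_one, hs1, map_one]
  -- translations by `L`
  have hv1 : Continuous fun l : ι → FiniteAdeleRing (𝓞 F) F =>
      (piAdeleSplit F ι (0, l), (0 : ι → AdeleRing (𝓞 F) F)) :=
    ((piAdeleSplit F ι).continuous.comp (continuous_const.prodMk continuous_id)).prodMk continuous_const
  have hv1f : ∀ l : ι → FiniteAdeleRing (𝓞 F) F,
      finIdem F • (piAdeleSplit F ι (0, l), (0 : ι → AdeleRing (𝓞 F) F)) =
        (piAdeleSplit F ι (0, l), (0 : ι → AdeleRing (𝓞 F) F)) := fun l => by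
    rw [Prod.smul_mk, finIdem_smul_piAdeleSplit_zero, smul_zero]
  have hv1a : ∀ l ∈ (L : Set (ι → FiniteAdeleRing (𝓞 F) F)),
      piFinite F ι (piAdeleSplit F ι (0, l), (0 : ι → AdeleRing (𝓞 F) F)).1 ∈ L := fun l hl => by
    rwa [piFinite_piAdeleSplit]
  have hv1b : ∀ l ∈ (L : Set (ι → FiniteAdeleRing (𝓞 F) F)),
      piFinite F ι (T *ᵥ (piAdeleSplit F ι (0, l), (0 : ι → AdeleRing (𝓞 F) F)).2) ∈ dualBox F ι L :=
    fun l _ => by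
    rw [Matrix.mulVec_zero, piFinite_zero_vec]
    exact (dualBox F ι L).zero_mem
  have hv1c : ∀ l ∈ (L : Set (ι → FiniteAdeleRing (𝓞 F) F)),
      polar (adelicForm F ι T) (piAdeleSplit F ι (0, l), (0 : ι → AdeleRing (𝓞 F) F))
        (piAdeleSplit F ι (0, l), (0 : ι → AdeleRing (𝓞 F) F)) = 0 := fun l _ => by
    rw [polar_apply, map_zero]
  have ev1 := eventually_forall_finSchrodinger_act_indicatorSB (T := T) hg h0 hv1 hv1f hLc L hLo hLc hv1a hv1b
    hv1c
  -- modulations by `L^♮`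
  have hv2 : Continuous fun y : ι → FiniteAdeleRing (𝓞 F) F => ((0 : ι → AdeleRing (𝓞 F) F),
      ((hT.unit⁻¹ : (Matrix ι ι (AdeleRing (𝓞 F) F))ˣ) : Matrix ι ι (AdeleRing (𝓞 F) F)) *ᵥ
        piAdeleSplit F ι (0, y)) :=
    continuous_const.prodMk (continuous_const.matrix_mulVec
      ((piAdeleSplit F ι).continuous.comp (continuous_const.prodMk continuous_id)))
  have hTinv : ∀ y : ι → FiniteAdeleRing (𝓞 F) F,
      T *ᵥ (((hT.unit⁻¹ : (Matrix ι ι (AdeleRing (𝓞 F) F))ˣ) : Matrix ι ι (AdeleRing (𝓞 F) F)) *ᵥ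
        piAdeleSplit F ι (0, y)) = piAdeleSplit F ι (0, y) := fun y => by
    rw [Matrix.mulVec_mulVec, hT.mul_val_inv, Matrix.one_mulVec]
  have hv2f : ∀ y : ι → FiniteAdeleRing (𝓞 F) F,
      finIdem F • ((0 : ι → AdeleRing (𝓞 F) F),
        ((hT.unit⁻¹ : (Matrix ι ι (AdeleRing (𝓞 F) F))ˣ) : Matrix ι ι (AdeleRing (𝓞 F) F)) *ᵥ
          piAdeleSplit F ι (0, y)) =
      ((0 : ι → AdeleRing (𝓞 F) F),
        ((hT.unit⁻¹ : (Matrix ι ι (AdeleRing (𝓞 F) F))ˣ) : Matrix ι ι (AdeleRing (𝓞 F) F)) *ᵥ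
          piAdeleSplit F ι (0, y)) := fun y => by
    rw [Prod.smul_mk, smul_zero, ← Matrix.mulVec_smul, finIdem_smul_piAdeleSplit_zero]
  have hv2a : ∀ y ∈ (dualBox F ι L : Set (ι → FiniteAdeleRing (𝓞 F) F)),
      piFinite F ι ((0 : ι → AdeleRing (𝓞 F) F),
        ((hT.unit⁻¹ : (Matrix ι ι (AdeleRing (𝓞 F) F))ˣ) : Matrix ι ι (AdeleRing (𝓞 F) F)) *ᵥ
          piAdeleSplit F ι (0, y)).1 ∈ L := fun y _ => by
    rw [piFinite_zero_vec]
    exact L.zero_mem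
  have hv2b : ∀ y ∈ (dualBox F ι L : Set (ι → FiniteAdeleRing (𝓞 F) F)),
      piFinite F ι (T *ᵥ ((0 : ι → AdeleRing (𝓞 F) F),
        ((hT.unit⁻¹ : (Matrix ι ι (AdeleRing (𝓞 F) F))ˣ) : Matrix ι ι (AdeleRing (𝓞 F) F)) *ᵥ
          piAdeleSplit F ι (0, y)).2) ∈ dualBox F ι L := fun y hy => by
    rwa [hTinv, piFinite_piAdeleSplit]
  have hv2c : ∀ y ∈ (dualBox F ι L : Set (ι → FiniteAdeleRing (𝓞 F) F)),
      polar (adelicForm F ι T)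
        ((0 : ι → AdeleRing (𝓞 F) F),
          ((hT.unit⁻¹ : (Matrix ι ι (AdeleRing (𝓞 F) F))ˣ) : Matrix ι ι (AdeleRing (𝓞 F) F)) *ᵥ
            piAdeleSplit F ι (0, y))
        ((0 : ι → AdeleRing (𝓞 F) F),
          ((hT.unit⁻¹ : (Matrix ι ι (AdeleRing (𝓞 F) F))ˣ) : Matrix ι ι (AdeleRing (𝓞 F) F)) *ᵥ
            piAdeleSplit F ι (0, y)) = 0 := fun y _ => by
    rw [polar_apply, map_zero, LinearMap.zero_apply]
  have ev2 := eventually_forall_finSchrodinger_act_indicatorSB (T := T) hg h0 hv2 hv2f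
    (isCompact_dualBox L hLo hLc) L hLo hLc hv2a hv2b hv2c
  filter_upwards [ev1, ev2] with h h1 h2 Mf hMf
  have hinv : adelicMpCont.proj F ι T (s h) * adelicMpCont.proj F ι T (s h⁻¹) = 1 := by
    simp only [← map_mul, hsinv, map_one]
  exact implementer_indicatorSB_eq_smul hT L hLo hLc hinv hMf h1 h2

end Rigidity


/-! ## §6′. Values of the generators; combination of decay estimates -/

section GeneratorValues

/-- Pointwise value of a pure tensor `Ψ ⊗ φ`. [folklore] -/
theorem coe_piSchwartzBruhatEquiv_tmul_apply (Ψ : 𝓢((ι → mixedSpace F), ℂ)) (φ : FinSB F ι)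
    (x : ι → AdeleRing (𝓞 F) F) :
    ((piSchwartzBruhatEquiv F ι (Ψ ⊗ₜ[ℂ] φ) : piSchwartzBruhat F ι) : (ι → AdeleRing (𝓞 F) F) → ℂ) x =
      Ψ (piArch F ι x) * (φ : (ι → FiniteAdeleRing (𝓞 F) F) → ℂ) (piFinite F ι x) := by
  rw [coe_piSchwartzBruhatEquiv_tmul]

variable [DecidableEq ι] (T : Matrix ι ι (AdeleRing (𝓞 F) F))

/-- `|ρ_f(η) 𝟙_L| ≤ 1` pointwise (`ρ_f(η) 𝟙_L` is a unimodular multiple of a translate of `𝟙_L`). [folklore] -/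
theorem norm_coe_finSchrodinger_indicatorSB_le_one (η : AdelicHeisenberg F ι T)
    (L : AddSubgroup (ι → FiniteAdeleRing (𝓞 F) F))
    (hLo : IsOpen (L : Set (ι → FiniteAdeleRing (𝓞 F) F)))
    (hLc : IsCompact (L : Set (ι → FiniteAdeleRing (𝓞 F) F))) (b : ι → FiniteAdeleRing (𝓞 F) F) :
    ‖((finSchrodinger T η (indicatorSB F ι L hLo hLc) : FinSB F ι) :
        (ι → FiniteAdeleRing (𝓞 F) F) → ℂ) b‖ ≤ 1 := by
  rw [coe_finSchrodinger_apply, norm_mul, norm_mul, Circle.norm_coe, Circle.norm_coe, one_mul, one_mul,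
    coe_indicatorSB]
  exact (norm_indicator_le_norm_self _ _).trans_eq norm_one

/-- **Value and support of a moved generator.** If `Φ = Ψ' ⊗ ρ_f(η') 𝟙_L` then `|Φ(x)| ≤ |Ψ'(x_∞)|`, and
`Φ(x) = 0` unless `(η'_1)_f + x_f ∈ L`. [folklore] -/
theorem generator_value_bounds (Ψ' : 𝓢((ι → mixedSpace F), ℂ)) (η' : AdelicHeisenberg F ι T)
    (L : AddSubgroup (ι → FiniteAdeleRing (𝓞 F) F))
    (hLo : IsOpen (L : Set (ι → FiniteAdeleRing (𝓞 F) F)))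
    (hLc : IsCompact (L : Set (ι → FiniteAdeleRing (𝓞 F) F))) {Φ : piSchwartzBruhat F ι}
    (hΦ : Φ = piSchwartzBruhatEquiv F ι (Ψ' ⊗ₜ[ℂ] finSchrodinger T η' (indicatorSB F ι L hLo hLc)))
    (x : ι → AdeleRing (𝓞 F) F) :
    ‖(Φ : (ι → AdeleRing (𝓞 F) F) → ℂ) x‖ ≤ ‖Ψ' (piArch F ι x)‖ ∧
      (piFinite F ι η'.v.1 + piFinite F ι x ∉ (L : Set (ι → FiniteAdeleRing (𝓞 F) F)) →
        (Φ : (ι → AdeleRing (𝓞 F) F) → ℂ) x = 0) := by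
  subst hΦ
  rw [coe_piSchwartzBruhatEquiv_tmul]
  beta_reduce
  refine ⟨?_, fun hb => ?_⟩
  · rw [norm_mul]
    exact (mul_le_mul_of_nonneg_left (norm_coe_finSchrodinger_indicatorSB_le_one T η' L hLo hLc _)
      (norm_nonneg _)).trans_eq (mul_one _)
  · rw [coe_finSchrodinger_apply, coe_indicatorSB, Set.indicator_of_notMem hb, mul_zero, mul_zero, mul_zero]

end GeneratorValues

section DecayCombinators

variable {G : Type*} [TopologicalSpace G] {g₀ : G} {k : ℕ} {n : ℕ}

/-- The zero family decays. [folklore] -/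
theorem decay_zero :
    ∃ V ∈ 𝓝 g₀, ∃ (M : ℝ) (Cf : Set (Fin n → FiniteAdeleRing (𝓞 F) F)), 0 ≤ M ∧ IsCompact Cf ∧
      ∀ g ∈ V,
        (∀ x, ‖((0 : piSchwartzBruhat F (Fin n)) : (Fin n → AdeleRing (𝓞 F) F) → ℂ) x‖ ≤
            M * (1 + ‖vecInfinitePart F n x‖) ^ (-(k : ℝ))) ∧
        (∀ x, vecFinitePart F n x ∉ Cf →
            ((0 : piSchwartzBruhat F (Fin n)) : (Fin n → AdeleRing (𝓞 F) F) → ℂ) x = 0) := by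
  refine ⟨univ, univ_mem, 0, ∅, le_rfl, isCompact_empty, fun g _ => ⟨fun x => ?_, fun x _ => rfl⟩⟩
  rw [ZeroMemClass.coe_zero, Pi.zero_apply, norm_zero, zero_mul]

/-- Sums of decaying families decay. [folklore] -/
theorem decay_add {f₁ f₂ : G → piSchwartzBruhat F (Fin n)}
    (h₁ : ∃ V ∈ 𝓝 g₀, ∃ (M : ℝ) (Cf : Set (Fin n → FiniteAdeleRing (𝓞 F) F)), 0 ≤ M ∧ IsCompact Cf ∧
      ∀ g ∈ V,
        (∀ x, ‖((f₁ g : piSchwartzBruhat F (Fin n)) : (Fin n → AdeleRing (𝓞 F) F) → ℂ) x‖ ≤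
            M * (1 + ‖vecInfinitePart F n x‖) ^ (-(k : ℝ))) ∧
        (∀ x, vecFinitePart F n x ∉ Cf →
            ((f₁ g : piSchwartzBruhat F (Fin n)) : (Fin n → AdeleRing (𝓞 F) F) → ℂ) x = 0))
    (h₂ : ∃ V ∈ 𝓝 g₀, ∃ (M : ℝ) (Cf : Set (Fin n → FiniteAdeleRing (𝓞 F) F)), 0 ≤ M ∧ IsCompact Cf ∧
      ∀ g ∈ V,
        (∀ x, ‖((f₂ g : piSchwartzBruhat F (Fin n)) : (Fin n → AdeleRing (𝓞 F) F) → ℂ) x‖ ≤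
            M * (1 + ‖vecInfinitePart F n x‖) ^ (-(k : ℝ))) ∧
        (∀ x, vecFinitePart F n x ∉ Cf →
            ((f₂ g : piSchwartzBruhat F (Fin n)) : (Fin n → AdeleRing (𝓞 F) F) → ℂ) x = 0)) :
    ∃ V ∈ 𝓝 g₀, ∃ (M : ℝ) (Cf : Set (Fin n → FiniteAdeleRing (𝓞 F) F)), 0 ≤ M ∧ IsCompact Cf ∧
      ∀ g ∈ V,
        (∀ x, ‖((f₁ g + f₂ g : piSchwartzBruhat F (Fin n)) : (Fin n → AdeleRing (𝓞 F) F) → ℂ) x‖ ≤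
            M * (1 + ‖vecInfinitePart F n x‖) ^ (-(k : ℝ))) ∧
        (∀ x, vecFinitePart F n x ∉ Cf →
            ((f₁ g + f₂ g : piSchwartzBruhat F (Fin n)) : (Fin n → AdeleRing (𝓞 F) F) → ℂ) x = 0) := by
  obtain ⟨V₁, hV₁, M₁, C₁, hM₁, hC₁, h₁⟩ := h₁
  obtain ⟨V₂, hV₂, M₂, C₂, hM₂, hC₂, h₂⟩ := h₂
  refine ⟨V₁ ∩ V₂, inter_mem hV₁ hV₂, M₁ + M₂, C₁ ∪ C₂, add_nonneg hM₁ hM₂, hC₁.union hC₂,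
    fun g hg => ⟨fun x => ?_, fun x hx => ?_⟩⟩
  · rw [Submodule.coe_add, Pi.add_apply]
    calc _ ≤ _ := norm_add_le _ _
      _ ≤ M₁ * _ + M₂ * _ := add_le_add ((h₁ g hg.1).1 x) ((h₂ g hg.2).1 x)
      _ = (M₁ + M₂) * (1 + ‖vecInfinitePart F n x‖) ^ (-(k : ℝ)) := by ring
  · rw [mem_union, not_or] at hx
    rw [Submodule.coe_add, Pi.add_apply, (h₁ g hg.1).2 x hx.1, (h₂ g hg.2).2 x hx.2, add_zero]

/-- Scalar multiples of decaying families decay. [folklore] -/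
theorem decay_smul {f₁ : G → piSchwartzBruhat F (Fin n)} (c : ℂ)
    (h₁ : ∃ V ∈ 𝓝 g₀, ∃ (M : ℝ) (Cf : Set (Fin n → FiniteAdeleRing (𝓞 F) F)), 0 ≤ M ∧ IsCompact Cf ∧
      ∀ g ∈ V,
        (∀ x, ‖((f₁ g : piSchwartzBruhat F (Fin n)) : (Fin n → AdeleRing (𝓞 F) F) → ℂ) x‖ ≤
            M * (1 + ‖vecInfinitePart F n x‖) ^ (-(k : ℝ))) ∧
        (∀ x, vecFinitePart F n x ∉ Cf →
            ((f₁ g : piSchwartzBruhat F (Fin n)) : (Fin n → AdeleRing (𝓞 F) F) → ℂ) x = 0)) :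
    ∃ V ∈ 𝓝 g₀, ∃ (M : ℝ) (Cf : Set (Fin n → FiniteAdeleRing (𝓞 F) F)), 0 ≤ M ∧ IsCompact Cf ∧
      ∀ g ∈ V,
        (∀ x, ‖((c • f₁ g : piSchwartzBruhat F (Fin n)) : (Fin n → AdeleRing (𝓞 F) F) → ℂ) x‖ ≤
            M * (1 + ‖vecInfinitePart F n x‖) ^ (-(k : ℝ))) ∧
        (∀ x, vecFinitePart F n x ∉ Cf →
            ((c • f₁ g : piSchwartzBruhat F (Fin n)) : (Fin n → AdeleRing (𝓞 F) F) → ℂ) x = 0) := by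
  obtain ⟨V, hV, M, C, hM, hC, h₁⟩ := h₁
  refine ⟨V, hV, ‖c‖ * M, C, mul_nonneg (norm_nonneg _) hM, hC, fun g hg => ⟨fun x => ?_, fun x hx => ?_⟩⟩
  · rw [Submodule.coe_smul, Pi.smul_apply, _root_.norm_smul, mul_assoc]
    exact mul_le_mul_of_nonneg_left ((h₁ g hg).1 x) (norm_nonneg _)
  · rw [Submodule.coe_smul, Pi.smul_apply, (h₁ g hg).2 x hx, smul_zero]

/-- Finite sums of decaying families decay. [folklore] -/
theorem decay_sum {α : Type*} (t : Finset α) (f : α → G → piSchwartzBruhat F (Fin n))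
    (hf : ∀ i ∈ t, ∃ V ∈ 𝓝 g₀, ∃ (M : ℝ) (Cf : Set (Fin n → FiniteAdeleRing (𝓞 F) F)), 0 ≤ M ∧ IsCompact Cf ∧
      ∀ g ∈ V,
        (∀ x, ‖((f i g : piSchwartzBruhat F (Fin n)) : (Fin n → AdeleRing (𝓞 F) F) → ℂ) x‖ ≤
            M * (1 + ‖vecInfinitePart F n x‖) ^ (-(k : ℝ))) ∧
        (∀ x, vecFinitePart F n x ∉ Cf →
            ((f i g : piSchwartzBruhat F (Fin n)) : (Fin n → AdeleRing (𝓞 F) F) → ℂ) x = 0)) :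
    ∃ V ∈ 𝓝 g₀, ∃ (M : ℝ) (Cf : Set (Fin n → FiniteAdeleRing (𝓞 F) F)), 0 ≤ M ∧ IsCompact Cf ∧
      ∀ g ∈ V,
        (∀ x, ‖((∑ i ∈ t, f i g : piSchwartzBruhat F (Fin n)) : (Fin n → AdeleRing (𝓞 F) F) → ℂ) x‖ ≤
            M * (1 + ‖vecInfinitePart F n x‖) ^ (-(k : ℝ))) ∧
        (∀ x, vecFinitePart F n x ∉ Cf →
            ((∑ i ∈ t, f i g : piSchwartzBruhat F (Fin n)) : (Fin n → AdeleRing (𝓞 F) F) → ℂ) x = 0) := by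
  classical
  induction t using Finset.induction_on with
  | empty =>
    simp_rw [Finset.sum_empty]
    exact decay_zero
  | insert a t ha ih =>
    simp_rw [Finset.sum_insert ha]
    exact decay_add (hf a (Finset.mem_insert_self a t)) (ih fun i hi => hf i (Finset.mem_insert_of_mem hi))


/-- A family pointwise equal to a decaying family decays. [folklore] -/
theorem decay_congr {f₁ f₂ : G → piSchwartzBruhat F (Fin n)}
    (he : ∀ g x, ((f₂ g : piSchwartzBruhat F (Fin n)) : (Fin n → AdeleRing (𝓞 F) F) → ℂ) x =
      ((f₁ g : piSchwartzBruhat F (Fin n)) : (Fin n → AdeleRing (𝓞 F) F) → ℂ) x)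
    (h₁ : ∃ V ∈ 𝓝 g₀, ∃ (M : ℝ) (Cf : Set (Fin n → FiniteAdeleRing (𝓞 F) F)), 0 ≤ M ∧ IsCompact Cf ∧
      ∀ g ∈ V,
        (∀ x, ‖((f₁ g : piSchwartzBruhat F (Fin n)) : (Fin n → AdeleRing (𝓞 F) F) → ℂ) x‖ ≤
            M * (1 + ‖vecInfinitePart F n x‖) ^ (-(k : ℝ))) ∧
        (∀ x, vecFinitePart F n x ∉ Cf →
            ((f₁ g : piSchwartzBruhat F (Fin n)) : (Fin n → AdeleRing (𝓞 F) F) → ℂ) x = 0)) :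
    ∃ V ∈ 𝓝 g₀, ∃ (M : ℝ) (Cf : Set (Fin n → FiniteAdeleRing (𝓞 F) F)), 0 ≤ M ∧ IsCompact Cf ∧
      ∀ g ∈ V,
        (∀ x, ‖((f₂ g : piSchwartzBruhat F (Fin n)) : (Fin n → AdeleRing (𝓞 F) F) → ℂ) x‖ ≤
            M * (1 + ‖vecInfinitePart F n x‖) ^ (-(k : ℝ))) ∧
        (∀ x, vecFinitePart F n x ∉ Cf →
            ((f₂ g : piSchwartzBruhat F (Fin n)) : (Fin n → AdeleRing (𝓞 F) F) → ℂ) x = 0) := by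
  obtain ⟨V, hV, M, C, hM, hC, h⟩ := h₁
  exact ⟨V, hV, M, C, hM, hC, fun g hg =>
    ⟨fun x => (congrArg Norm.norm (he g x)).trans_le ((h g hg).1 x), fun x hx => (he g x).trans ((h g hg).2 x hx)⟩⟩

/-- Pulling a decaying family back along a map continuous at a point. [folklore] -/
theorem decay_comp {G' : Type*} [TopologicalSpace G'] {g₀' : G'} {f₁ : G → piSchwartzBruhat F (Fin n)}
    (m : G' → G) (hm : ContinuousAt m g₀') (hm0 : m g₀' = g₀)
    (h₁ : ∃ V ∈ 𝓝 g₀, ∃ (M : ℝ) (Cf : Set (Fin n → FiniteAdeleRing (𝓞 F) F)), 0 ≤ M ∧ IsCompact Cf ∧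
      ∀ g ∈ V,
        (∀ x, ‖((f₁ g : piSchwartzBruhat F (Fin n)) : (Fin n → AdeleRing (𝓞 F) F) → ℂ) x‖ ≤
            M * (1 + ‖vecInfinitePart F n x‖) ^ (-(k : ℝ))) ∧
        (∀ x, vecFinitePart F n x ∉ Cf →
            ((f₁ g : piSchwartzBruhat F (Fin n)) : (Fin n → AdeleRing (𝓞 F) F) → ℂ) x = 0)) :
    ∃ V ∈ 𝓝 g₀', ∃ (M : ℝ) (Cf : Set (Fin n → FiniteAdeleRing (𝓞 F) F)), 0 ≤ M ∧ IsCompact Cf ∧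
      ∀ g ∈ V,
        (∀ x, ‖((f₁ (m g) : piSchwartzBruhat F (Fin n)) : (Fin n → AdeleRing (𝓞 F) F) → ℂ) x‖ ≤
            M * (1 + ‖vecInfinitePart F n x‖) ^ (-(k : ℝ))) ∧
        (∀ x, vecFinitePart F n x ∉ Cf →
            ((f₁ (m g) : piSchwartzBruhat F (Fin n)) : (Fin n → AdeleRing (𝓞 F) F) → ℂ) x = 0) := by
  obtain ⟨V, hV, M, C, hM, hC, h⟩ := h₁
  refine ⟨m ⁻¹' V, hm.preimage_mem_nhds ?_, M, C, hM, hC, fun g hg => h (m g) hg⟩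
  rw [hm0]
  exact hV

end DecayCombinators

/-! ## §6. Locally uniform decay and the theta majorants -/

section Decay

variable {n : ℕ} {T : Matrix (Fin n) (Fin n) (AdeleRing (𝓞 F) F)}
  {H : Type*} [Group H] [TopologicalSpace H] [IsTopologicalGroup H]
  (hT : IsUnit T) (s : H → adelicMpCont F (Fin n) T) (hsm : ∀ a b : H, s (a * b) = s a * s b)
  (hs : Continuous s)
  (Winf : H → (𝓢((Fin n → mixedSpace F), ℂ) →L[ℂ] 𝓢((Fin n → mixedSpace F), ℂ)))
  (w0 : ∀ h, Winf h ≠ 0) (w1 : ∀ Φ, Continuous fun h => Winf h Φ)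
  (w2 : ∀ (h : H) (a w : Fin n → mixedSpace F) (Φ : 𝓢((Fin n → mixedSpace F), ℂ)),
    Winf h (archModTrans F (Fin n) T a w Φ) =
      weilPhase T (adelicMpCont.proj F (Fin n) T (s h)) (a, w) •
        archModTrans F (Fin n) T (archAct T (adelicMpCont.proj F (Fin n) T (s h)) (a, w)).1
          (archAct T (adelicMpCont.proj F (Fin n) T (s h)) (a, w)).2 (Winf h Φ))

omit [TopologicalSpace H] [IsTopologicalGroup H] in
include hsm in
/-- A multiplicative section maps `1` to `1` and satisfies `s(h) s(h⁻¹) = 1`. [folklore] -/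
theorem section_map_one_mul_inv : s 1 = 1 ∧ ∀ h : H, s h * s h⁻¹ = 1 := by
  have h1 : s 1 = 1 := mul_left_cancel (a := s 1) (by simp only [← hsm, mul_one])
  exact ⟨h1, fun h => by rw [← hsm, mul_inv_cancel, h1]⟩

include hT hsm hs w0 w2 in
/-- **Factorisation on the generators near `1`.** For `h` near `1` there is ONE scalar `κ_h` with
`ω(s h)(Ψ ⊗ ρ_f(η) 𝟙_L) = (κ_h W_∞(h) Ψ) ⊗ ρ_f(π(s h) η) 𝟙_L` for all `Ψ` and all finite `η`
(stripping `exists_factors_of_archModTrans_covariant` + rigidity `eventually_implementer_indicatorSB_eq_smul`).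
[cite: Weil1964, Chap. III n° 41, Lemme 5 p. 192] -/
theorem eventually_exists_generator_factor (L : AddSubgroup (Fin n → FiniteAdeleRing (𝓞 F) F))
    (hLo : IsOpen (L : Set (Fin n → FiniteAdeleRing (𝓞 F) F)))
    (hLc : IsCompact (L : Set (Fin n → FiniteAdeleRing (𝓞 F) F))) :
    ∀ᶠ h in 𝓝 (1 : H), ∃ κ : ℂ, ∀ (Ψ : 𝓢((Fin n → mixedSpace F), ℂ)) (η : AdelicHeisenberg F (Fin n) T),
      η ∈ finHeisenberg T →
      adelicMpCont.omega F (Fin n) T (s h)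
          (piSchwartzBruhatEquiv F (Fin n) (Ψ ⊗ₜ finSchrodinger T η (indicatorSB F (Fin n) L hLo hLc))) =
        piSchwartzBruhatEquiv F (Fin n) ((κ • Winf h Ψ) ⊗ₜ
          finSchrodinger T ((ofSymplectic (polar (adelicForm F (Fin n) T))
            (adelicMpCont.proj F (Fin n) T (s h))).act η) (indicatorSB F (Fin n) L hLo hLc)) := by
  filter_upwards [eventually_implementer_indicatorSB_eq_smul hT s hs (section_map_one_mul_inv s hsm).1
    (section_map_one_mul_inv s hsm).2 L hLo hLc] with h hrig
  have hex := exists_factors_of_archModTrans_covariant hT (s h) (Winf h) (w0 h) (w2 h)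
  rcases hex with ⟨c, B, -, hB, hfac⟩
  have hr' : ∃ a : ℂ, B (indicatorSB F (Fin n) L hLo hLc) = a • indicatorSB F (Fin n) L hLo hLc :=
    ⟨_, hrig B hB⟩
  rcases hr' with ⟨a, ha⟩
  refine ⟨c * a, fun Ψ η hη => ?_⟩
  -- `B (ρ_f(η) 𝟙_L) = ρ_f(π(s h) η) (B 𝟙_L) = a • ρ_f(π(s h) η) 𝟙_L` (term-mode: `rw` is prohibitively slow
  -- on goals containing `π(s h)`).
  have hcomp : B (finSchrodinger T η (indicatorSB F (Fin n) L hLo hLc)) =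
      finSchrodinger T ((ofSymplectic (polar (adelicForm F (Fin n) T))
        (adelicMpCont.proj F (Fin n) T (s h))).act η) (B (indicatorSB F (Fin n) L hLo hLc)) :=
    LinearMap.congr_fun (comp_finSchrodinger_of_finImplementer hB hη) (indicatorSB F (Fin n) L hLo hLc)
  have h3 : B (finSchrodinger T η (indicatorSB F (Fin n) L hLo hLc)) =
      a • finSchrodinger T ((ofSymplectic (polar (adelicForm F (Fin n) T))
        (adelicMpCont.proj F (Fin n) T (s h))).act η) (indicatorSB F (Fin n) L hLo hLc) :=
    hcomp.trans (((finSchrodinger T ((ofSymplectic (polar (adelicForm F (Fin n) T))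
        (adelicMpCont.proj F (Fin n) T (s h))).act η)).congr_arg ha).trans (map_smul _ _ _))
  have h4 : ∀ X : FinSB F (Fin n),
      (c • Winf h Ψ) ⊗ₜ[ℂ] (a • X) = ((c * a) • Winf h Ψ) ⊗ₜ[ℂ] X := fun X => by
    rw [TensorProduct.tmul_smul, TensorProduct.smul_tmul', smul_smul, mul_comm a c]
  have e1 := hfac Ψ (finSchrodinger T η (indicatorSB F (Fin n) L hLo hLc))
  exact e1.trans ((congrArg (fun φ : FinSB F (Fin n) =>
    piSchwartzBruhatEquiv F (Fin n) ((c • Winf h Ψ) ⊗ₜ[ℂ] φ)) h3).trans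
      (congrArg (piSchwartzBruhatEquiv F (Fin n)) (h4 _)))

set_option maxHeartbeats 800000 in
omit [IsTopologicalGroup H] in
include hs w0 w1 in
/-- **The scalars `κ_h` are bounded near `1`**: `κ_h (W_∞(h)Ψ₀)(u₀) = (ω(s h)(Ψ₀ ⊗ 𝟙_L))(u₀, 0)` is a
continuous matrix coefficient and `(W_∞(h)Ψ₀)(u₀)` stays away from `0` near `1`. [folklore] -/
theorem exists_bound_generator_factor (L : AddSubgroup (Fin n → FiniteAdeleRing (𝓞 F) F))
    (hLo : IsOpen (L : Set (Fin n → FiniteAdeleRing (𝓞 F) F)))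
    (hLc : IsCompact (L : Set (Fin n → FiniteAdeleRing (𝓞 F) F))) :
    ∃ K : ℝ, 0 ≤ K ∧ ∀ᶠ h in 𝓝 (1 : H), ∀ κ : ℂ,
      (∀ (Ψ : 𝓢((Fin n → mixedSpace F), ℂ)) (η : AdelicHeisenberg F (Fin n) T), η ∈ finHeisenberg T →
        adelicMpCont.omega F (Fin n) T (s h)
            (piSchwartzBruhatEquiv F (Fin n) (Ψ ⊗ₜ finSchrodinger T η (indicatorSB F (Fin n) L hLo hLc))) =
          piSchwartzBruhatEquiv F (Fin n) ((κ • Winf h Ψ) ⊗ₜ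
            finSchrodinger T ((ofSymplectic (polar (adelicForm F (Fin n) T))
              (adelicMpCont.proj F (Fin n) T (s h))).act η) (indicatorSB F (Fin n) L hLo hLc))) →
      ‖κ‖ ≤ K := by
  -- a non-vanishing matrix coefficient of `W_∞(1)`
  have hexD : ∃ (Ψ₀ : 𝓢((Fin n → mixedSpace F), ℂ)) (u₀ : Fin n → mixedSpace F), Winf 1 Ψ₀ u₀ ≠ 0 := by
    by_contra hcon
    push Not at hcon
    exact w0 1 (ContinuousLinearMap.ext fun Ψ => SchwartzMap.ext fun u => by
      rw [hcon Ψ u]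
      rfl)
  rcases hexD with ⟨Ψ₀, u₀, hD⟩
  have hexx : ∃ x₀ : Fin n → AdeleRing (𝓞 F) F, x₀ = piAdeleSplit F (Fin n) (u₀, 0) := ⟨_, rfl⟩
  rcases hexx with ⟨x₀, hx₀⟩
  have hexΦ : ∃ Φ₀ : piSchwartzBruhat F (Fin n), Φ₀ = piSchwartzBruhatEquiv F (Fin n)
      (Ψ₀ ⊗ₜ finSchrodinger T 1 (indicatorSB F (Fin n) L hLo hLc)) := ⟨_, rfl⟩
  rcases hexΦ with ⟨Φ₀, hΦ₀⟩
  -- the two continuous coefficients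
  have hDc : Continuous fun h : H => Winf h Ψ₀ u₀ :=
    (IsArchFactor.of_continuous (A := fun h Φ => Winf h Φ) w1).continuous_eval Ψ₀ u₀
  have hNc : Continuous fun h : H => ((adelicMpCont.omega F (Fin n) T (s h) Φ₀ : piSchwartzBruhat F (Fin n)) :
      (Fin n → AdeleRing (𝓞 F) F) → ℂ) x₀ :=
    (adelicMpCont.continuous_omega_apply Φ₀ x₀).comp hs
  have hDpos : 0 < ‖Winf 1 Ψ₀ u₀‖ := norm_pos_iff.2 hD
  have hVD : {h : H | ‖Winf 1 Ψ₀ u₀‖ / 2 < ‖Winf h Ψ₀ u₀‖} ∈ 𝓝 (1 : H) :=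
    (isOpen_lt continuous_const (continuous_norm.comp hDc)).mem_nhds (by
      simp only [mem_setOf_eq]
      exact half_lt_self hDpos)
  have hVN : {h : H | ‖((adelicMpCont.omega F (Fin n) T (s h) Φ₀ : piSchwartzBruhat F (Fin n)) :
      (Fin n → AdeleRing (𝓞 F) F) → ℂ) x₀‖ <
      ‖((adelicMpCont.omega F (Fin n) T (s 1) Φ₀ : piSchwartzBruhat F (Fin n)) :
        (Fin n → AdeleRing (𝓞 F) F) → ℂ) x₀‖ + 1} ∈ 𝓝 (1 : H) :=
    (isOpen_lt (continuous_norm.comp hNc) continuous_const).mem_nhds (by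
      simp only [mem_setOf_eq]
      exact lt_add_one _)
  refine ⟨(‖((adelicMpCont.omega F (Fin n) T (s 1) Φ₀ : piSchwartzBruhat F (Fin n)) :
      (Fin n → AdeleRing (𝓞 F) F) → ℂ) x₀‖ + 1) / (‖Winf 1 Ψ₀ u₀‖ / 2), by positivity, ?_⟩
  filter_upwards [hVD, hVN] with h hDh hNh κ hκ
  -- `N(h) = κ D(h)`
  have hone_mem : (1 : AdelicHeisenberg F (Fin n) T) ∈ finHeisenberg T := by
    rw [mem_finHeisenberg_iff, Heisenberg.one_v, smul_zero]
  have hact1 : (ofSymplectic (polar (adelicForm F (Fin n) T)) (adelicMpCont.proj F (Fin n) T (s h))).act 1 = 1 := by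
    rw [← Heisenberg.PseudoSymplectic.toAut_apply]
    exact map_one _
  have hone : ((finSchrodinger T (1 : AdelicHeisenberg F (Fin n) T) (indicatorSB F (Fin n) L hLo hLc) :
      FinSB F (Fin n)) : (Fin n → FiniteAdeleRing (𝓞 F) F) → ℂ) 0 = 1 := by
    rw [coe_finSchrodinger_apply, Heisenberg.one_t, Heisenberg.one_v, AddChar.map_zero_eq_one]
    simp only [Prod.snd_zero, Prod.fst_zero, Matrix.mulVec_zero, piFinite_zero_vec, Pi.zero_apply, zero_mul,
      Finset.sum_const_zero, AddChar.map_zero_eq_one, add_zero, coe_indicatorSB,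
      Set.indicator_of_mem (L.zero_mem : (0 : Fin n → FiniteAdeleRing (𝓞 F) F) ∈ (L : Set _)),
      Circle.coe_one, one_mul]
  have hN : ((adelicMpCont.omega F (Fin n) T (s h) Φ₀ : piSchwartzBruhat F (Fin n)) :
      (Fin n → AdeleRing (𝓞 F) F) → ℂ) x₀ = κ * Winf h Ψ₀ u₀ := by
    have e := congrArg (fun Φ : piSchwartzBruhat F (Fin n) => (Φ : (Fin n → AdeleRing (𝓞 F) F) → ℂ) x₀)
      (hκ Ψ₀ 1 hone_mem)
    rw [hΦ₀]
    refine e.trans ?_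
    rw [hact1, coe_piSchwartzBruhatEquiv_tmul]
    beta_reduce
    rw [hx₀, piArch_piAdeleSplit, piFinite_piAdeleSplit]
    show (κ • Winf h Ψ₀) u₀ * ((finSchrodinger T (1 : AdelicHeisenberg F (Fin n) T)
      (indicatorSB F (Fin n) L hLo hLc) : FinSB F (Fin n)) : (Fin n → FiniteAdeleRing (𝓞 F) F) → ℂ) 0 = _
    rw [hone, mul_one, smul_apply, smul_eq_mul]
  have h1 : ‖κ‖ * ‖Winf h Ψ₀ u₀‖ ≤
      ‖((adelicMpCont.omega F (Fin n) T (s 1) Φ₀ : piSchwartzBruhat F (Fin n)) :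
        (Fin n → AdeleRing (𝓞 F) F) → ℂ) x₀‖ + 1 := by
    rw [← norm_mul, ← hN]
    exact le_of_lt hNh
  rw [le_div_iff₀ (by positivity)]
  calc ‖κ‖ * (‖Winf 1 Ψ₀ u₀‖ / 2) ≤ ‖κ‖ * ‖Winf h Ψ₀ u₀‖ :=
        mul_le_mul_of_nonneg_left hDh.le (norm_nonneg _)
    _ ≤ _ := h1

include hT hsm hs w0 w1 w2 in
/-- **Decay and support of a moved generator near `1`** (Weil's Lemme 5 for `ω_ψ ∘ s` on the generator
`Ψ ⊗ T_a 𝟙_L`): for `h` near `1`, `ω(s h)(Ψ ⊗ T_a 𝟙_L) = (κ_h W_∞(h)Ψ) ⊗ ρ_f(π(s h) v̂_a) 𝟙_L` with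
`|κ_h| ≤ K` (`exists_bound_generator_factor`), `W_∞(h)Ψ` uniformly rapidly decreasing
(`IsArchFactor.of_continuous`), and `ρ_f(π(s h) v̂_a) 𝟙_L` bounded by `1` and supported in
`-((π(s h) v_a)_1)_f + L = -a + L`. [cite: Weil1964, Chap. III n° 41, Lemme 5 p. 192] -/
theorem decay_generator (L : AddSubgroup (Fin n → FiniteAdeleRing (𝓞 F) F))
    (hLo : IsOpen (L : Set (Fin n → FiniteAdeleRing (𝓞 F) F)))
    (hLc : IsCompact (L : Set (Fin n → FiniteAdeleRing (𝓞 F) F))) (Ψ : 𝓢((Fin n → mixedSpace F), ℂ))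
    (a : Fin n → FiniteAdeleRing (𝓞 F) F) (k : ℕ) :
    ∃ V ∈ 𝓝 (1 : H), ∃ (M : ℝ) (Cf : Set (Fin n → FiniteAdeleRing (𝓞 F) F)), 0 ≤ M ∧ IsCompact Cf ∧
      ∀ g ∈ V,
        (∀ x, ‖((adelicMpCont.omega F (Fin n) T (s g) (piSchwartzBruhatEquiv F (Fin n)
          (Ψ ⊗ₜ[ℂ] finTranslateSB F (Fin n) a (indicatorSB F (Fin n) L hLo hLc))) : piSchwartzBruhat F (Fin n)) : (Fin n → AdeleRing (𝓞 F) F) → ℂ) x‖ ≤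
            M * (1 + ‖vecInfinitePart F n x‖) ^ (-(k : ℝ))) ∧
        (∀ x, vecFinitePart F n x ∉ Cf →
            ((adelicMpCont.omega F (Fin n) T (s g) (piSchwartzBruhatEquiv F (Fin n)
          (Ψ ⊗ₜ[ℂ] finTranslateSB F (Fin n) a (indicatorSB F (Fin n) L hLo hLc))) : piSchwartzBruhat F (Fin n)) : (Fin n → AdeleRing (𝓞 F) F) → ℂ) x = 0) := by
  -- the generator as `Ψ ⊗ ρ_f(v̂_a) 𝟙_L`, `v_a = ((0, a), 0)`
  have hexv : ∃ va : (Fin n → AdeleRing (𝓞 F) F) × (Fin n → AdeleRing (𝓞 F) F),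
      va = (piAdeleSplit F (Fin n) (0, a), 0) := ⟨_, rfl⟩
  rcases hexv with ⟨va, hva⟩
  have hηa : Heisenberg.ofVec (polar (adelicForm F (Fin n) T)) va ∈ finHeisenberg T := by
    rw [hva]
    exact ofVec_mem_finHeisenberg (finIdem_smul_piAdeleSplit_zero a) (smul_zero _)
  have hgen : finTranslateSB F (Fin n) a (indicatorSB F (Fin n) L hLo hLc) =
      finSchrodinger T (Heisenberg.ofVec (polar (adelicForm F (Fin n) T)) va)
        (indicatorSB F (Fin n) L hLo hLc) := by
    rw [hva, finSchrodinger_ofVec_inl]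
  have hva1 : piFinite F (Fin n) va.1 = a := by rw [hva, piFinite_piAdeleSplit]
  -- the neighbourhoods: factorisation with ONE scalar, bound on the scalar, archimedean decay, position
  have hK := exists_bound_generator_factor s hs Winf w0 w1 L hLo hLc
  rcases hK with ⟨K, hK0, evK⟩
  have evF := eventually_exists_generator_factor hT s hsm hs Winf w0 w2 L hLo hLc
  have hexa := (IsArchFactor.of_continuous (A := fun h Φ => Winf h Φ) w1).decay Ψ k 1
  rcases hexa with ⟨Va, hVa, S, hS0, hS⟩
  have hcc : Continuous fun g : H => piFinite F (Fin n)
      (((adelicMpCont.proj F (Fin n) T (s g) : symplecticGroup (polar (adelicForm F (Fin n) T))) :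
        ((Fin n → AdeleRing (𝓞 F) F) × (Fin n → AdeleRing (𝓞 F) F)) ≃ₗ[AdeleRing (𝓞 F) F]
          ((Fin n → AdeleRing (𝓞 F) F) × (Fin n → AdeleRing (𝓞 F) F))) va).1 :=
    continuous_piFinite.comp (continuous_fst.comp ((adelicMpCont.continuous_proj_apply va).comp hs))
  have hVp : {g : H | -a + piFinite F (Fin n)
      (((adelicMpCont.proj F (Fin n) T (s g) : symplecticGroup (polar (adelicForm F (Fin n) T))) :
        ((Fin n → AdeleRing (𝓞 F) F) × (Fin n → AdeleRing (𝓞 F) F)) ≃ₗ[AdeleRing (𝓞 F) F]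
          ((Fin n → AdeleRing (𝓞 F) F) × (Fin n → AdeleRing (𝓞 F) F))) va).1 ∈
      (L : Set (Fin n → FiniteAdeleRing (𝓞 F) F))} ∈ 𝓝 (1 : H) := by
    refine (hLo.preimage (continuous_const.add hcc)).mem_nhds ?_
    show -a + piFinite F (Fin n)
      (((adelicMpCont.proj F (Fin n) T (s 1) : symplecticGroup (polar (adelicForm F (Fin n) T))) :
        ((Fin n → AdeleRing (𝓞 F) F) × (Fin n → AdeleRing (𝓞 F) F)) ≃ₗ[AdeleRing (𝓞 F) F]
          ((Fin n → AdeleRing (𝓞 F) F) × (Fin n → AdeleRing (𝓞 F) F))) va).1 ∈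
      (L : Set (Fin n → FiniteAdeleRing (𝓞 F) F))
    rw [(section_map_one_mul_inv s hsm).1, map_one]
    show -a + piFinite F (Fin n) va.1 ∈ (L : Set (Fin n → FiniteAdeleRing (𝓞 F) F))
    rw [hva1, neg_add_cancel]
    exact L.zero_mem
  refine ⟨_, inter_mem (evF.and evK) (inter_mem hVa hVp), K * S,
    (Homeomorph.addLeft a) ⁻¹' (L : Set (Fin n → FiniteAdeleRing (𝓞 F) F)), mul_nonneg hK0 hS0,
    (Homeomorph.addLeft a).isCompact_preimage.2 hLc, fun g hg => ?_⟩
  rcases hg with ⟨⟨⟨κ, hκ⟩, hKg⟩, hga, hgp⟩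
  have hκK : ‖κ‖ ≤ K := hKg κ hκ
  have e1 := hκ Ψ (Heisenberg.ofVec (polar (adelicForm F (Fin n) T)) va) hηa
  have e0 : adelicMpCont.omega F (Fin n) T (s g) (piSchwartzBruhatEquiv F (Fin n)
        (Ψ ⊗ₜ[ℂ] finTranslateSB F (Fin n) a (indicatorSB F (Fin n) L hLo hLc))) =
      adelicMpCont.omega F (Fin n) T (s g) (piSchwartzBruhatEquiv F (Fin n)
        (Ψ ⊗ₜ[ℂ] finSchrodinger T (Heisenberg.ofVec (polar (adelicForm F (Fin n) T)) va)
          (indicatorSB F (Fin n) L hLo hLc))) :=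
    congrArg (fun φ : FinSB F (Fin n) => adelicMpCont.omega F (Fin n) T (s g)
      (piSchwartzBruhatEquiv F (Fin n) (Ψ ⊗ₜ[ℂ] φ))) hgen
  have hvb := fun x => generator_value_bounds T (κ • Winf g Ψ)
    ((ofSymplectic (polar (adelicForm F (Fin n) T)) (adelicMpCont.proj F (Fin n) T (s g))).act
      (Heisenberg.ofVec (polar (adelicForm F (Fin n) T)) va)) L hLo hLc (e0.trans e1) x
  refine ⟨fun x => (hvb x).1.trans ?_, fun x hx => (hvb x).2 ?_⟩
  · rw [smul_apply, smul_eq_mul, norm_mul, mul_assoc]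
    exact mul_le_mul hκK (hS g hga _) (norm_nonneg _) hK0
  · rw [act_ofVec_v]
    intro hmem
    apply hx
    show a + piFinite F (Fin n) x ∈ (L : Set (Fin n → FiniteAdeleRing (𝓞 F) F))
    have e : a + piFinite F (Fin n) x = -(-a + piFinite F (Fin n)
        (((adelicMpCont.proj F (Fin n) T (s g) : symplecticGroup (polar (adelicForm F (Fin n) T))) :
          ((Fin n → AdeleRing (𝓞 F) F) × (Fin n → AdeleRing (𝓞 F) F)) ≃ₗ[AdeleRing (𝓞 F) F]
            ((Fin n → AdeleRing (𝓞 F) F) × (Fin n → AdeleRing (𝓞 F) F))) va).1) +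
      (piFinite F (Fin n)
        (((adelicMpCont.proj F (Fin n) T (s g) : symplecticGroup (polar (adelicForm F (Fin n) T))) :
          ((Fin n → AdeleRing (𝓞 F) F) × (Fin n → AdeleRing (𝓞 F) F)) ≃ₗ[AdeleRing (𝓞 F) F]
            ((Fin n → AdeleRing (𝓞 F) F) × (Fin n → AdeleRing (𝓞 F) F))) va).1 + piFinite F (Fin n) x) := by
      abel
    rw [e]
    exact L.add_mem (L.neg_mem hgp) hmem

include hT hsm hs w0 w1 w2 in
/-- **Locally uniform decay near `1`** for every `Φ ∈ 𝒮(𝔸_F^n)`: reduce to the generators `Ψ ⊗ T_a 𝟙_{L_𝔫}`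
(`exists_level_of_mem_schwartzBruhat`, `exists_eq_sum_smul_finTranslateSB_indicatorSB`) and combine
(`decay_generator`, `decay_sum`, `decay_smul`, `decay_add`). [cite: Weil1964, Chap. III n° 41, Lemme 5 p. 192] -/
theorem decay_near_one (Φ : piSchwartzBruhat F (Fin n)) (k : ℕ) :
    ∃ V ∈ 𝓝 (1 : H), ∃ (M : ℝ) (Cf : Set (Fin n → FiniteAdeleRing (𝓞 F) F)), 0 ≤ M ∧ IsCompact Cf ∧
      ∀ g ∈ V,
        (∀ x, ‖((adelicMpCont.omega F (Fin n) T (s g) Φ : piSchwartzBruhat F (Fin n)) : (Fin n → AdeleRing (𝓞 F) F) → ℂ) x‖ ≤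
            M * (1 + ‖vecInfinitePart F n x‖) ^ (-(k : ℝ))) ∧
        (∀ x, vecFinitePart F n x ∉ Cf →
            ((adelicMpCont.omega F (Fin n) T (s g) Φ : piSchwartzBruhat F (Fin n)) : (Fin n → AdeleRing (𝓞 F) F) → ℂ) x = 0) := by
  obtain ⟨Φ, hΦ⟩ := Φ
  induction hΦ using Submodule.span_induction with
  | mem Φ hfac =>
    obtain ⟨Ψ, Φf, hfin, rfl⟩ := hfac
    have hexl := exists_level_of_mem_schwartzBruhat F hfin
    rcases hexl with ⟨𝔫, -, hlev⟩
    have hext := exists_eq_sum_smul_finTranslateSB_indicatorSB (piLevelIdeal F (Fin n) 𝔫)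
      (isOpen_piLevelIdeal F 𝔫) (isCompact_piLevelIdeal F (Fin n) 𝔫) (⟨Φf, hfin⟩ : FinSB F (Fin n)) hlev
    rcases hext with ⟨t, ht⟩
    -- the factorizable function as a combination of generators `Ψ ⊗ T_{-q} 𝟙_{L_𝔫}`
    have hgen : (⟨_, Submodule.subset_span ⟨Ψ, Φf, hfin, rfl⟩⟩ : piSchwartzBruhat F (Fin n)) =
        ∑ q ∈ t, ((⟨Φf, hfin⟩ : FinSB F (Fin n)) : (Fin n → FiniteAdeleRing (𝓞 F) F) → ℂ) q.out •
          piSchwartzBruhatEquiv F (Fin n) (Ψ ⊗ₜ[ℂ]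
            finTranslateSB F (Fin n) (-(q.out : Fin n → FiniteAdeleRing (𝓞 F) F))
              (indicatorSB F (Fin n) (piLevelIdeal F (Fin n) 𝔫) (isOpen_piLevelIdeal F 𝔫)
                (isCompact_piLevelIdeal F (Fin n) 𝔫))) := by
      have e1 : (⟨_, Submodule.subset_span ⟨Ψ, Φf, hfin, rfl⟩⟩ : piSchwartzBruhat F (Fin n)) =
          piSchwartzBruhatEquiv F (Fin n) (Ψ ⊗ₜ[ℂ] (⟨Φf, hfin⟩ : FinSB F (Fin n))) := by
        apply Subtype.ext
        rw [coe_piSchwartzBruhatEquiv_tmul]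
      conv_lhs => rw [e1, ht, TensorProduct.tmul_sum, map_sum]
      refine Finset.sum_congr rfl fun q _ => ?_
      rw [TensorProduct.tmul_smul, map_smul]
    refine decay_congr (f₁ := fun g => ∑ q ∈ t,
      ((⟨Φf, hfin⟩ : FinSB F (Fin n)) : (Fin n → FiniteAdeleRing (𝓞 F) F) → ℂ) q.out •
        adelicMpCont.omega F (Fin n) T (s g) (piSchwartzBruhatEquiv F (Fin n) (Ψ ⊗ₜ[ℂ]
          finTranslateSB F (Fin n) (-(q.out : Fin n → FiniteAdeleRing (𝓞 F) F))
            (indicatorSB F (Fin n) (piLevelIdeal F (Fin n) 𝔫) (isOpen_piLevelIdeal F 𝔫)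
              (isCompact_piLevelIdeal F (Fin n) 𝔫)))))
      (fun g x => congrArg (fun Φ' : piSchwartzBruhat F (Fin n) => (Φ' : (Fin n → AdeleRing (𝓞 F) F) → ℂ) x)
        ((congrArg (fun Φ' : piSchwartzBruhat F (Fin n) => adelicMpCont.omega F (Fin n) T (s g) Φ') hgen).trans
          ((map_sum (adelicMpCont.omega F (Fin n) T (s g)) _ t).trans
            (Finset.sum_congr rfl fun q _ => map_smul (adelicMpCont.omega F (Fin n) T (s g)) _ _)))) ?_
    exact decay_sum t _ fun q _ => decay_smul _ (decay_generator hT s hsm hs Winf w0 w1 w2 _ _ _ Ψ _ k)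
  | zero =>
    exact decay_congr (f₁ := fun _ => (0 : piSchwartzBruhat F (Fin n)))
      (fun g x => congrArg (fun Φ' : piSchwartzBruhat F (Fin n) => (Φ' : (Fin n → AdeleRing (𝓞 F) F) → ℂ) x)
        (map_zero (adelicMpCont.omega F (Fin n) T (s g)))) decay_zero
  | add Φ Ψ hΦ hΨ ihΦ ihΨ =>
    exact decay_congr
      (f₁ := fun g => adelicMpCont.omega F (Fin n) T (s g) ⟨Φ, hΦ⟩ + adelicMpCont.omega F (Fin n) T (s g) ⟨Ψ, hΨ⟩)
      (fun g x => congrArg (fun Φ' : piSchwartzBruhat F (Fin n) => (Φ' : (Fin n → AdeleRing (𝓞 F) F) → ℂ) x)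
        (map_add (adelicMpCont.omega F (Fin n) T (s g)) ⟨Φ, hΦ⟩ ⟨Ψ, hΨ⟩)) (decay_add ihΦ ihΨ)
  | smul c Φ hΦ ih =>
    exact decay_congr (f₁ := fun g => c • adelicMpCont.omega F (Fin n) T (s g) ⟨Φ, hΦ⟩)
      (fun g x => congrArg (fun Φ' : piSchwartzBruhat F (Fin n) => (Φ' : (Fin n → AdeleRing (𝓞 F) F) → ℂ) x)
        (map_smul (adelicMpCont.omega F (Fin n) T (s g)) c ⟨Φ, hΦ⟩)) (decay_smul c ih)

include hT hsm hs w0 w1 w2 in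
/-- **Locally uniform decay near any `h₀`**, by translating `decay_near_one` with
`ω(s h) Φ = ω(s(h h₀⁻¹)) (ω(s h₀) Φ)`. [cite: Weil1964, Chap. III n° 41, Lemme 5 p. 192] -/
theorem decay_near (Φ : piSchwartzBruhat F (Fin n)) (k : ℕ) (h₀ : H) :
    ∃ V ∈ 𝓝 (h₀), ∃ (M : ℝ) (Cf : Set (Fin n → FiniteAdeleRing (𝓞 F) F)), 0 ≤ M ∧ IsCompact Cf ∧
      ∀ g ∈ V,
        (∀ x, ‖((adelicMpCont.omega F (Fin n) T (s g) Φ : piSchwartzBruhat F (Fin n)) : (Fin n → AdeleRing (𝓞 F) F) → ℂ) x‖ ≤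
            M * (1 + ‖vecInfinitePart F n x‖) ^ (-(k : ℝ))) ∧
        (∀ x, vecFinitePart F n x ∉ Cf →
            ((adelicMpCont.omega F (Fin n) T (s g) Φ : piSchwartzBruhat F (Fin n)) : (Fin n → AdeleRing (𝓞 F) F) → ℂ) x = 0) := by
  have e : ∀ g : H, s g = s (g * h₀⁻¹) * s h₀ := fun g => by rw [← hsm, inv_mul_cancel_right]
  have heq : ∀ g : H, adelicMpCont.omega F (Fin n) T (s g) Φ =
      adelicMpCont.omega F (Fin n) T (s (g * h₀⁻¹)) (adelicMpCont.omega F (Fin n) T (s h₀) Φ) := fun g =>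
    LinearMap.congr_fun ((congrArg (fun q => adelicMpCont.omega F (Fin n) T q) (e g)).trans
      (map_mul (adelicMpCont.omega F (Fin n) T) _ _)) Φ
  exact decay_congr (f₁ := fun g => adelicMpCont.omega F (Fin n) T (s (g * h₀⁻¹))
      (adelicMpCont.omega F (Fin n) T (s h₀) Φ))
    (fun g x => congrArg (fun Φ' : piSchwartzBruhat F (Fin n) => (Φ' : (Fin n → AdeleRing (𝓞 F) F) → ℂ) x)
      (heq g))
    (decay_comp (f₁ := fun g => adelicMpCont.omega F (Fin n) T (s g) (adelicMpCont.omega F (Fin n) T (s h₀) Φ))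
      (fun h : H => h * h₀⁻¹) (continuous_id.mul continuous_const).continuousAt (mul_inv_cancel h₀)
      (decay_near_one hT s hsm hs Winf w0 w1 w2 (adelicMpCont.omega F (Fin n) T (s h₀) Φ) k))

/-- **Weil's theta majorants for `h ↦ ω_ψ(s h)`** (Weil 1964, Chap. III n° 41, Lemme 5 / Théorème 6(1)):
for a continuous homomorphism `s : H → Mp_ψ(W_𝔸)ᶜᵒⁿᵗ` (`T` invertible) admitting an archimedean
`ψ_∞`-covariant family `W_∞` — `W_∞(h) ≠ 0`, strongly continuous, and
`W_∞(h) ρ_∞(u) = χ_h(u) ρ_∞(π(s h) u) W_∞(h)` in Folland's coordinates — the family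
`h ↦ ω_ψ(s h)` on `𝒮(𝔸_F^n)` `HasThetaMajorants`: `ξ ↦ (ω(s h)Φ)(ξ)` is dominated, locally uniformly
in `h`, by a summable function on `F^n`.  (Such a `W_∞` exists whenever the archimedean component of
`π ∘ s` lifts continuously to the real metaplectic group; it is supplied by the user.)
[cite: Weil1964, Chap. III n° 41 Lemme 5 p. 192, Théorème 6 (1) p. 193; MoeglinVignerasWaldspurger1987, Chap. 2 II.1; Folland1989, Prop. (1.43)] -/
theorem hasThetaMajorants_omega_comp (hT : IsUnit T) (s : H →* adelicMpCont F (Fin n) T)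
    (hs : Continuous s)
    (Winf : H → (𝓢((Fin n → mixedSpace F), ℂ) →L[ℂ] 𝓢((Fin n → mixedSpace F), ℂ)))
    (w0 : ∀ h, Winf h ≠ 0) (w1 : ∀ Φ, Continuous fun h => Winf h Φ)
    (w2 : ∀ (h : H) (a w : Fin n → mixedSpace F) (Φ : 𝓢((Fin n → mixedSpace F), ℂ)),
      Winf h (archModTrans F (Fin n) T a w Φ) =
        weilPhase T (adelicMpCont.proj F (Fin n) T (s h)) (a, w) •
          archModTrans F (Fin n) T (archAct T (adelicMpCont.proj F (Fin n) T (s h)) (a, w)).1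
            (archAct T (adelicMpCont.proj F (Fin n) T (s h)) (a, w)).2 (Winf h Φ)) :
    HasThetaMajorants (F := F) fun h Φ => adelicMpCont.omega F (Fin n) T (s h) Φ := by
  refine HasThetaMajorants.of_decay
    (fun Φ ξ => (adelicMpCont.continuous_omega_apply Φ (ratPt F (Fin n) ξ)).comp hs) fun Φ g₀ => ?_
  have hk : ∃ k : ℕ, (n : ℝ) * Module.finrank ℚ F < k :=
    ⟨⌊(n : ℝ) * Module.finrank ℚ F⌋₊ + 1, by
      rw [Nat.cast_add, Nat.cast_one]; exact Nat.lt_floor_add_one _⟩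
  rcases hk with ⟨k, hk⟩
  have hd := decay_near hT s (map_mul s) hs Winf w0 w1 w2 Φ k g₀
  rcases hd with ⟨V, hV, M, Cf, hM, hCf, hdec⟩
  exact ⟨V, hV, M, k, Cf, hM, hCf, hk, hdec⟩


end Decay

end Literature.NumberTheory.Weil1964

end
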